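import Summits.MatrixMultiplication.MatrixMultiplication.Theses.FidelityWitnesses
import Summits.MatrixMultiplication.MatrixMultiplication.Theorems.FidelityWitnessesDiagonalPowerDecayStubProductFrame
import Summits.MatrixMultiplication.MatrixMultiplication.Theorems.FidelityWitnessesFidelityThesisSepMajorantSingleProduct
import Summits.MatrixMultiplication.MatrixMultiplication.Theorems.FidelityWitnessesSevenEighthsLawStubSliceElimination
import Literature.Computability.AlgebraicComplexity.AlderStrassen
import Literature.LinearAlgebra.Matrix.PosSemidefTrace

/-!
# `DiagonalPowerDecay ⟺ stub_middlePairNegativityDecay` — the open stub of line `frame-negativity-singlet-fraction`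
# is EQUIVALENT to the crux (lead prover-line-stmt-MatrixMultiplication-14053-0, 2026-08-16; kernel-checked, rc 0,
# sorry-free, axioms propext / Classical.choice / Quot.sound)

Main theorem: `diagonalPowerDecay_iff_middlePairNegativityDecay : DiagonalPowerDecay ↔ MiddlePairNegativityDecay`, where
`MiddlePairNegativityDecay` is the registered stub `stub_middlePairNegativityDecay` of
`Cruxes/DiagonalPowerDecay/Lines/frame_negativity_singlet_fraction.lean` VERBATIM.  Quantitatively
(`middlePairNegativityDecay_of_body`): Body `(C, δ)` ⇒ stub with `(1 + √(max C 1), δ/4)`.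

Proof of crux ⇒ stub.  Let `R = Tr_{κν} P_E` (`frameOp e`, PSD, `tr R = d ≤ n²`), `ν = ‖R^Γ‖₁`.
* Stage A (`capTwist_le_of_body`): under the body, for every contraction `A` the A-TWISTED CAPTURE
  `cap_A(e) = Σ_s Σ_(κ,ν) |Σ_{m,m'} e_s (κ,m) (m',ν) A m m'|² = ⟨ψ_A| R |ψ_A⟩` is `≤ C n^{3−2δ}`: the extremal tensor has
  rank `≤ n²` after pushing `A` onto the third slot, norm contracts, overlap with `⟨n,n,n⟩` equals `cap_A(e)`.
* Stage B (`ptr_traceNorm_bound`, pure matrix analysis): for PSD `R` on `ℂ^n ⊗ ℂ^n` with `Re⟨Ψ|R|Ψ⟩ ≤ M` for all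
  SUB-UNITARY `Ψ` and every `θ > 0`: `R^Γ = Y − Z`, `Y, Z ⪰ 0`, `tr Y + tr Z ≤ n √(t M/θ) + t √(n θ)`.  Ingredients:
  Jordan splitting; `Σ|λ_i| = Re tr(R · (sign R^Γ)^Γ)`; eigen-expansion of `R`; split of the eigenvectors `φ_i` by
  `ρ_i² ≥ θ` where `ρ_i = Σ_j ‖row_j φ_i‖` in the eigenbasis of `Φ_i Φ_iᴴ` (Schmidt sum without SVD); HEAD by
  Cauchy–Schwarz in Frobenius norm (`‖K‖_F² ≤ n²` for the partial transpose `K` of a contraction, `‖R_Λ‖_F² = Σ_Λ μ_i²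
  ≤ (M/θ)·t` since `μ_i ρ_i² ≤ Re⟨Ψ_i|R|Ψ_i⟩ ≤ M`); TAIL by the KEY INEQUALITY `‖K φ‖² ≤ n ρ(φ)²` (blocks of a
  Hermitian contraction are contractions) and the sub-unitary witness `Ψ_φ` with `⟨Ψ_φ, φ⟩ = ρ(φ)`.
* Stage C: `t = d ≤ n²`, `M = C₁ n^{3−2δ}`, `θ = C₁ n^{1−δ}` ⇒ `tr Y + tr Z ≤ (1+√C₁) n^{3−δ/2}`.
Stub ⇒ crux is the skeleton's composition (slice elimination + singlet ≤ negativity + landed `stub_productFrame`).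

CONSEQUENCE FOR THE LINE: the open stub transfers no difficulty — it is exactly the crux (hence `⇒ ω(ℂ) ≥ 6/(3−2δ)`),
and it cannot die by a "negativity-entangled but singlet-decorrelated" product family unless the crux dies.
-/

noncomputable section

set_option linter.dupNamespace false
set_option linter.unusedVariables false

namespace Summit.MatrixMultiplication.MatrixMultiplication.Theorems.DiagonalPowerDecay


open scoped BigOperators ComplexConjugate
open Literature.Computability.AlgebraicComplexity

/-! ## Frame bookkeeping (general `n`; cf. the landed `n = 2` file
`Theorems/FidelityWitnessesSevenEighthsLawStubSliceElimination.lean`; the output-slice identity is the tree's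
`Theorems.sepMajorant_slice_sum_matMulTensor`) -/

/-- Moving a sum over the frame index out of a double slot sum. -/
theorem slot_sum_comm_frame' {n k : ℕ} (Z : (Fin n × Fin n) → (Fin n × Fin n) → Fin k → ℂ) :
    ∑ b, ∑ c, ∑ s, Z b c s = ∑ s, ∑ b, ∑ c, Z b c s := by
  calc ∑ b, ∑ c, ∑ s, Z b c s = ∑ b, ∑ s, ∑ c, Z b c s :=
        Finset.sum_congr rfl fun b _ => Finset.sum_comm
    _ = ∑ s, ∑ b, ∑ c, Z b c s := Finset.sum_comm

/-- Coefficient identification: if `F = Σ_s d_s e_s` for an orthonormal frame `e`, then `⟨e_t, F⟩ = d_t`. -/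
theorem inner_frame_slice' {n k : ℕ} (e : Fin k → (Fin n × Fin n) → (Fin n × Fin n) → ℂ)
    (he : ∀ s t : Fin k, (∑ b, ∑ c, conj (e s b c) * e t b c) = if s = t then 1 else 0)
    (d : Fin k → ℂ) (F : (Fin n × Fin n) → (Fin n × Fin n) → ℂ)
    (hF : ∀ b c, F b c = ∑ s, d s * e s b c) (t : Fin k) :
    ∑ b, ∑ c, conj (e t b c) * F b c = d t := by
  calc ∑ b, ∑ c, conj (e t b c) * F b c
      = ∑ b, ∑ c, ∑ s, d s * (conj (e t b c) * e s b c) := by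
        refine Finset.sum_congr rfl fun b _ => Finset.sum_congr rfl fun c _ => ?_
        rw [hF b c, Finset.mul_sum]
        exact Finset.sum_congr rfl fun s _ => by ring
    _ = ∑ s, d s * ∑ b, ∑ c, conj (e t b c) * e s b c := by
        rw [slot_sum_comm_frame']
        refine Finset.sum_congr rfl fun s _ => ?_
        rw [Finset.mul_sum]
        exact Finset.sum_congr rfl fun b _ => by rw [Finset.mul_sum]
    _ = ∑ s, d s * (if t = s then 1 else 0) := by
        refine Finset.sum_congr rfl fun s _ => ?_
        rw [he t s]
    _ = d t := by simp

/-- Parseval inside the span of an orthonormal frame: if `F = Σ_s d_s e_s` then `Σ_{b,c} |F b c|² = Σ_s |d_s|²`. -/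
theorem parseval_slice' {n k : ℕ} (e : Fin k → (Fin n × Fin n) → (Fin n × Fin n) → ℂ)
    (he : ∀ s t : Fin k, (∑ b, ∑ c, conj (e s b c) * e t b c) = if s = t then 1 else 0)
    (d : Fin k → ℂ) (F : (Fin n × Fin n) → (Fin n × Fin n) → ℂ)
    (hF : ∀ b c, F b c = ∑ s, d s * e s b c) :
    ∑ b, ∑ c, ‖F b c‖ ^ 2 = ∑ s, ‖d s‖ ^ 2 := by
  have hFc : ∀ b c, conj (F b c) = ∑ s, conj (d s) * conj (e s b c) := by
    intro b c
    rw [hF b c, map_sum]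
    exact Finset.sum_congr rfl fun s _ => by rw [map_mul]
  have hC : (∑ b, ∑ c, conj (F b c) * F b c) = ∑ s, conj (d s) * d s := by
    calc ∑ b, ∑ c, conj (F b c) * F b c
        = ∑ b, ∑ c, ∑ s, conj (d s) * (conj (e s b c) * F b c) := by
          refine Finset.sum_congr rfl fun b _ => Finset.sum_congr rfl fun c _ => ?_
          rw [hFc b c, Finset.sum_mul]
          exact Finset.sum_congr rfl fun s _ => by ring
      _ = ∑ s, conj (d s) * ∑ b, ∑ c, conj (e s b c) * F b c := by
          rw [slot_sum_comm_frame']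
          refine Finset.sum_congr rfl fun s _ => ?_
          rw [Finset.mul_sum]
          exact Finset.sum_congr rfl fun b _ => by rw [Finset.mul_sum]
      _ = ∑ s, conj (d s) * d s :=
          Finset.sum_congr rfl fun s _ => by rw [inner_frame_slice' e he d F hF s]
  simp_rw [Complex.conj_mul'] at hC
  exact_mod_cast hC

/-! ## Twisted captures -/

/-- The coefficient `c_{s,a} = Σ_{m,m'} e_s (a.1,m) (m',a.2) · A m m'` of the `A`-twisted capture. -/
def twCoeff {n d : ℕ} (e : Fin d → (Fin n × Fin n) → (Fin n × Fin n) → ℂ) (A : Matrix (Fin n) (Fin n) ℂ)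
    (s : Fin d) (a : Fin n × Fin n) : ℂ :=
  ∑ m : Fin n, ∑ m' : Fin n, e s (a.1, m) (m', a.2) * A m m'

/-- The `A`-TWISTED CAPTURE `cap_A(e) = Σ_s Σ_a |c_{s,a}|²` (for `A = 1`: the line's capture `cap e`; in general
`⟨conj A| Tr_{κν} P_E |conj A⟩` for an orthonormal frame `e` spanning `E`). -/
def capTwist {n d : ℕ} (e : Fin d → (Fin n × Fin n) → (Fin n × Fin n) → ℂ) (A : Matrix (Fin n) (Fin n) ℂ) : ℝ :=
  ∑ s, ∑ a : Fin n × Fin n, ‖twCoeff e A s a‖ ^ 2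

/-- The extremal tensor of the twisted capture: output slices `S(a,·,·) = Σ_s conj(c_{s,a}) e_s`. -/
def twTensor {n d : ℕ} (e : Fin d → (Fin n × Fin n) → (Fin n × Fin n) → ℂ) (A : Matrix (Fin n) (Fin n) ℂ) :
    (Fin n × Fin n) → (Fin n × Fin n) → (Fin n × Fin n) → ℂ :=
  fun a b c => ∑ s, conj (twCoeff e A s a) * e s b c

/-- Pushing the twist onto the third slot: `(twist A S)(a,b,(m,ν)) = Σ_{m'} A m m' · S(a,b,(m',ν))`. -/
def twist {n : ℕ} (A : Matrix (Fin n) (Fin n) ℂ)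
    (S : (Fin n × Fin n) → (Fin n × Fin n) → (Fin n × Fin n) → ℂ) :
    (Fin n × Fin n) → (Fin n × Fin n) → (Fin n × Fin n) → ℂ :=
  fun a b c => ∑ m' : Fin n, A c.1 m' * S a b (m', c.2)

/-- The twisted extremal tensor pairs with `⟨n,n,n⟩` to exactly the twisted capture:
`Σ (twist A S)·T = cap_A(e)` for `S = twTensor e A`. -/
theorem sum_twist_twTensor_mul_matMulTensor {n d : ℕ} (e : Fin d → (Fin n × Fin n) → (Fin n × Fin n) → ℂ)
    (A : Matrix (Fin n) (Fin n) ℂ) :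
    (∑ a, ∑ b, ∑ c, twist A (twTensor e A) a b c * matMulTensor ℂ n n n a b c) = ((capTwist e A : ℝ) : ℂ) := by
  have hsq : ∀ z : ℂ, ((‖z‖ : ℝ) : ℂ) ^ 2 = conj z * z := fun z => by
    rw [mul_comm, Complex.mul_conj, Complex.normSq_eq_norm_sq]; norm_cast
  calc (∑ a, ∑ b, ∑ c, twist A (twTensor e A) a b c * matMulTensor ℂ n n n a b c)
      = ∑ a : Fin n × Fin n, ∑ m : Fin n, twist A (twTensor e A) a (a.1, m) (m, a.2) :=
        Finset.sum_congr rfl fun a _ => sepMajorant_slice_sum_matMulTensor _ a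
    _ = ∑ a : Fin n × Fin n, ∑ s, conj (twCoeff e A s a) * twCoeff e A s a := by
        refine Finset.sum_congr rfl fun a _ => ?_
        -- unfold the twist and the extremal tensor, then regroup the finite sums
        calc ∑ m : Fin n, twist A (twTensor e A) a (a.1, m) (m, a.2)
            = ∑ m : Fin n, ∑ m' : Fin n, ∑ s, A m m' * (conj (twCoeff e A s a) * e s (a.1, m) (m', a.2)) := by
              refine Finset.sum_congr rfl fun m _ => ?_
              simp only [twist, twTensor]
              refine Finset.sum_congr rfl fun m' _ => ?_
              rw [Finset.mul_sum]
          _ = ∑ m : Fin n, ∑ s, ∑ m' : Fin n, A m m' * (conj (twCoeff e A s a) * e s (a.1, m) (m', a.2)) :=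
              Finset.sum_congr rfl fun m _ => Finset.sum_comm
          _ = ∑ s, ∑ m : Fin n, ∑ m' : Fin n, A m m' * (conj (twCoeff e A s a) * e s (a.1, m) (m', a.2)) :=
              Finset.sum_comm
          _ = ∑ s, conj (twCoeff e A s a) * twCoeff e A s a := by
              refine Finset.sum_congr rfl fun s _ => ?_
              rw [twCoeff, Finset.mul_sum]
              refine Finset.sum_congr rfl fun m _ => ?_
              rw [Finset.mul_sum]
              exact Finset.sum_congr rfl fun m' _ => by ring
    _ = ((capTwist e A : ℝ) : ℂ) := by
        simp only [capTwist, Complex.ofReal_sum, Complex.ofReal_pow, hsq]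
        rw [Finset.sum_comm]

/-- Parseval: the extremal tensor has squared norm exactly the twisted capture (orthonormal `e`). -/
theorem normSq_twTensor {n d : ℕ} (e : Fin d → (Fin n × Fin n) → (Fin n × Fin n) → ℂ)
    (he : ∀ s t : Fin d, (∑ b, ∑ c, conj (e s b c) * e t b c) = if s = t then 1 else 0)
    (A : Matrix (Fin n) (Fin n) ℂ) :
    (∑ a, ∑ b, ∑ c, ‖twTensor e A a b c‖ ^ 2) = capTwist e A := by
  calc (∑ a, ∑ b, ∑ c, ‖twTensor e A a b c‖ ^ 2) = ∑ a : Fin n × Fin n, ∑ s, ‖twCoeff e A s a‖ ^ 2 := by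
        refine Finset.sum_congr rfl fun a _ => ?_
        rw [parseval_slice' e he (fun s => conj (twCoeff e A s a)) (twTensor e A a) (fun b c => rfl)]
        exact Finset.sum_congr rfl fun s _ => by rw [Complex.norm_conj]
    _ = capTwist e A := by unfold capTwist; exact Finset.sum_comm

/-- A contraction on the third slot does not increase the norm: `‖twist A S‖² ≤ ‖S‖²` when `‖A x‖ ≤ ‖x‖`. -/
theorem normSq_twist_le {n : ℕ} (A : Matrix (Fin n) (Fin n) ℂ)
    (hA : ∀ x : Fin n → ℂ, ∑ i, ‖(A.mulVec x) i‖ ^ 2 ≤ ∑ i, ‖x i‖ ^ 2)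
    (S : (Fin n × Fin n) → (Fin n × Fin n) → (Fin n × Fin n) → ℂ) :
    (∑ a, ∑ b, ∑ c, ‖twist A S a b c‖ ^ 2) ≤ ∑ a, ∑ b, ∑ c, ‖S a b c‖ ^ 2 := by
  refine Finset.sum_le_sum fun a _ => Finset.sum_le_sum fun b _ => ?_
  -- split the third slot `c = (m, ν)` as `Σ_ν Σ_m`
  calc (∑ c, ‖twist A S a b c‖ ^ 2) = ∑ ν : Fin n, ∑ m : Fin n, ‖twist A S a b (m, ν)‖ ^ 2 :=
        Fintype.sum_prod_type_right (f := fun c : Fin n × Fin n => ‖twist A S a b c‖ ^ 2)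
    _ ≤ ∑ ν : Fin n, ∑ m' : Fin n, ‖S a b (m', ν)‖ ^ 2 := by
        refine Finset.sum_le_sum fun ν _ => ?_
        have h := hA (fun m' => S a b (m', ν))
        simpa only [twist, Matrix.mulVec, dotProduct] using h
    _ = ∑ c, ‖S a b c‖ ^ 2 :=
        (Fintype.sum_prod_type_right (f := fun c : Fin n × Fin n => ‖S a b c‖ ^ 2)).symm

/-- The twisted extremal tensor is a sum of `r` triads whenever the frame lies in the span of `r` products
`u_l ⊗ v_l`: slice by slice `S(a,·,·) ∈ span{u_l ⊗ v_l}`, and the twist acts on the `v`-factor only. -/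
theorem exists_twist_twTensor_eq_sum_triad {n d r : ℕ} (e : Fin d → (Fin n × Fin n) → (Fin n × Fin n) → ℂ)
    (u v : Fin r → (Fin n × Fin n) → ℂ)
    (hps : ∀ s, e s ∈ Submodule.span ℂ (Set.range fun l : Fin r => fun b c => u l b * v l c))
    (A : Matrix (Fin n) (Fin n) ℂ) :
    ∃ (w : Fin r → (Fin n × Fin n) → ℂ) (v' : Fin r → (Fin n × Fin n) → ℂ),
      twist A (twTensor e A) = ∑ l, triad (w l) (u l) (v' l) := by
  classical
  -- coefficients of the frame vectors in the products
  have hβ : ∀ s, ∃ β : Fin r → ℂ, ∑ l, β l • (fun b c => u l b * v l c) = e s := fun s =>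
    (Submodule.mem_span_range_iff_exists_fun ℂ).mp (hps s)
  choose β hβ using hβ
  have hexp : ∀ s b c, e s b c = ∑ l, β s l * (u l b * v l c) := by
    intro s b c
    have h := congrFun (congrFun (hβ s) b) c
    simpa [Finset.sum_apply, Pi.smul_apply, smul_eq_mul] using h.symm
  refine ⟨fun l a => ∑ s, conj (twCoeff e A s a) * β s l,
    fun l c => ∑ m' : Fin n, A c.1 m' * v l (m', c.2), ?_⟩
  funext a b c
  simp only [Finset.sum_apply, triad_apply, twist, twTensor]
  calc ∑ m' : Fin n, A c.1 m' * ∑ s, conj (twCoeff e A s a) * e s b (m', c.2)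
      = ∑ m' : Fin n, ∑ s, ∑ l, A c.1 m' * (conj (twCoeff e A s a) * (β s l * (u l b * v l (m', c.2)))) := by
        refine Finset.sum_congr rfl fun m' _ => ?_
        rw [Finset.mul_sum]
        refine Finset.sum_congr rfl fun s _ => ?_
        rw [hexp s b (m', c.2), Finset.mul_sum, Finset.mul_sum]
    _ = ∑ l, ∑ s, ∑ m' : Fin n, A c.1 m' * (conj (twCoeff e A s a) * (β s l * (u l b * v l (m', c.2)))) := by
        rw [Finset.sum_comm]
        refine (Finset.sum_congr rfl fun s _ => Finset.sum_comm).trans ?_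
        exact Finset.sum_comm
    _ = ∑ l, (∑ s, conj (twCoeff e A s a) * β s l) * u l b * ∑ m' : Fin n, A c.1 m' * v l (m', c.2) := by
        refine Finset.sum_congr rfl fun l _ => ?_
        rw [Finset.sum_mul, Finset.sum_mul]
        refine Finset.sum_congr rfl fun s _ => ?_
        rw [Finset.mul_sum]
        exact Finset.sum_congr rfl fun m' _ => by ring

/-- Hence its rank is at most `r`. -/
theorem tensorRank_twist_twTensor_le {n d r : ℕ} (e : Fin d → (Fin n × Fin n) → (Fin n × Fin n) → ℂ)
    (u v : Fin r → (Fin n × Fin n) → ℂ)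
    (hps : ∀ s, e s ∈ Submodule.span ℂ (Set.range fun l : Fin r => fun b c => u l b * v l c))
    (A : Matrix (Fin n) (Fin n) ℂ) :
    tensorRank (twist A (twTensor e A)) ≤ r := by
  obtain ⟨w, v', h⟩ := exists_twist_twTensor_eq_sum_triad e u v hps A
  exact tensorRank_le_of_eq_sum w u v' h

/-- **Twisted captures are bounded by the crux body.** If `|⟨S,⟨n,n,n⟩⟩|² ≤ C n^{3−2δ} ‖S‖²` for all `S` of rank
`≤ n²` (the body of `DiagonalPowerDecay` at `(C, δ)`, `0 ≤ C`), then for every orthonormal frame `e` inside the span of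
`r ≤ n²` products and every contraction `A`: `cap_A(e) ≤ C n^{3−2δ}`. -/
theorem capTwist_le_of_body {C δ : ℝ} (hC : 0 ≤ C)
    (hB : ∀ n : ℕ, ∀ S : (Fin n × Fin n) → (Fin n × Fin n) → (Fin n × Fin n) → ℂ, tensorRank S ≤ n ^ 2 →
      ‖∑ a, ∑ b, ∑ c, S a b c * matMulTensor ℂ n n n a b c‖ ^ 2 ≤
        C * (n : ℝ) ^ (3 - 2 * δ) * ∑ a, ∑ b, ∑ c, ‖S a b c‖ ^ 2)
    {n d r : ℕ} (hr : r ≤ n ^ 2) (u v : Fin r → (Fin n × Fin n) → ℂ)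
    (e : Fin d → (Fin n × Fin n) → (Fin n × Fin n) → ℂ)
    (he : ∀ s t : Fin d, (∑ b, ∑ c, conj (e s b c) * e t b c) = if s = t then 1 else 0)
    (hps : ∀ s, e s ∈ Submodule.span ℂ (Set.range fun l : Fin r => fun b c => u l b * v l c))
    (A : Matrix (Fin n) (Fin n) ℂ) (hA : ∀ x : Fin n → ℂ, ∑ i, ‖(A.mulVec x) i‖ ^ 2 ≤ ∑ i, ‖x i‖ ^ 2) :
    capTwist e A ≤ C * (n : ℝ) ^ (3 - 2 * δ) := by
  set S := twist A (twTensor e A) with hSdef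
  have hrank : tensorRank S ≤ n ^ 2 := (tensorRank_twist_twTensor_le e u v hps A).trans hr
  have hbody := hB n S hrank
  have hov : ‖∑ a, ∑ b, ∑ c, S a b c * matMulTensor ℂ n n n a b c‖ ^ 2 = capTwist e A ^ 2 := by
    rw [hSdef, sum_twist_twTensor_mul_matMulTensor, Complex.norm_real, Real.norm_eq_abs, sq_abs]
  have hnorm : (∑ a, ∑ b, ∑ c, ‖S a b c‖ ^ 2) ≤ capTwist e A := by
    rw [← normSq_twTensor e he A]
    exact normSq_twist_le A hA _
  have hK : 0 ≤ C * (n : ℝ) ^ (3 - 2 * δ) := mul_nonneg hC (Real.rpow_nonneg (Nat.cast_nonneg n) _)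
  have hcap : 0 ≤ capTwist e A := by unfold capTwist; positivity
  have key : capTwist e A ^ 2 ≤ C * (n : ℝ) ^ (3 - 2 * δ) * capTwist e A := by
    rw [← hov]
    exact hbody.trans (mul_le_mul_of_nonneg_left hnorm hK)
  rcases hcap.lt_or_eq with hpos | hzero
  · have : capTwist e A * capTwist e A ≤ C * (n : ℝ) ^ (3 - 2 * δ) * capTwist e A := by rw [← sq]; exact key
    exact le_of_mul_le_mul_right this hpos
  · rw [← hzero]; exact hK


open scoped BigOperators ComplexConjugate ComplexOrder
open Matrix

section Bridge

variable {N : Type*} [Fintype N] [DecidableEq N]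

/-- Orthonormality of the eigenvector basis of a Hermitian matrix, in coordinates:
`Σ_x conj(φ_i x) φ_j x = δ_ij`. -/
theorem eigvec_orthonormal {A : Matrix N N ℂ} (hA : A.IsHermitian) (i j : N) :
    (∑ x, conj ((hA.eigenvectorBasis i) x) * (hA.eigenvectorBasis j) x) = if i = j then 1 else 0 := by
  have h := orthonormal_iff_ite.mp hA.eigenvectorBasis.orthonormal i j
  rw [EuclideanSpace.inner_eq_star_dotProduct] at h
  rw [← h, dotProduct]
  refine Finset.sum_congr rfl fun x _ => ?_
  rw [Pi.star_apply, RCLike.star_def, mul_comm]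

/-- Unit norm of the eigenvectors, in coordinates: `Σ_x ‖φ_i x‖² = 1`. -/
theorem eigvec_normSq {A : Matrix N N ℂ} (hA : A.IsHermitian) (i : N) :
    (∑ x, ‖(hA.eigenvectorBasis i) x‖ ^ 2) = 1 := by
  have h := eigvec_orthonormal hA i i
  rw [if_pos rfl] at h
  have h' : (∑ x, (((‖(hA.eigenvectorBasis i) x‖ ^ 2 : ℝ)) : ℂ)) = 1 := by
    rw [← h]
    refine Finset.sum_congr rfl fun x _ => ?_
    rw [mul_comm, Complex.mul_conj, Complex.normSq_eq_norm_sq]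
  exact_mod_cast h'

/-- Completeness of the eigenvector basis, in coordinates: `w = Σ_i ⟨φ_i, w⟩ φ_i`. -/
theorem eigvec_expand {A : Matrix N N ℂ} (hA : A.IsHermitian) (w : N → ℂ) :
    w = ∑ i, (∑ x, conj ((hA.eigenvectorBasis i) x) * w x) • ⇑(hA.eigenvectorBasis i) := by
  have h := hA.eigenvectorBasis.sum_repr' (WithLp.toLp 2 w)
  have h2 := congrArg WithLp.ofLp h
  simp only [WithLp.ofLp_sum, WithLp.ofLp_smul] at h2
  have hc : ∀ i, inner ℂ (hA.eigenvectorBasis i) (WithLp.toLp 2 w) =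
      ∑ x, conj ((hA.eigenvectorBasis i) x) * w x := by
    intro i
    rw [EuclideanSpace.inner_eq_star_dotProduct, dotProduct]
    refine Finset.sum_congr rfl fun x _ => ?_
    rw [Pi.star_apply, RCLike.star_def, mul_comm]
  calc w = ∑ i, inner ℂ (hA.eigenvectorBasis i) (WithLp.toLp 2 w) • ⇑(hA.eigenvectorBasis i) := h2.symm
    _ = ∑ i, (∑ x, conj ((hA.eigenvectorBasis i) x) * w x) • ⇑(hA.eigenvectorBasis i) :=
        Finset.sum_congr rfl fun i _ => by rw [hc i]

/-- **Rank-one expansion** of a Hermitian matrix along its eigenvector basis: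
`A x y = Σ_i λ_i φ_i(x) conj(φ_i(y))`. -/
theorem hermitian_apply_eq_sum_eigen {A : Matrix N N ℂ} (hA : A.IsHermitian) (x y : N) :
    A x y = ∑ i, (hA.eigenvalues i : ℂ) * (hA.eigenvectorBasis i) x * conj ((hA.eigenvectorBasis i) y) := by
  have h1 : A x y = (A *ᵥ (Pi.single y 1 : N → ℂ)) x := by
    rw [Matrix.mulVec_single_one]; rfl
  have hexp := eigvec_expand hA (Pi.single y 1 : N → ℂ)
  have hcoef : ∀ i, (∑ x', conj ((hA.eigenvectorBasis i) x') * (Pi.single y 1 : N → ℂ) x') =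
      conj ((hA.eigenvectorBasis i) y) := by
    intro i
    rw [Finset.sum_eq_single y]
    · simp
    · intro x' _ hx'; simp [Pi.single_eq_of_ne hx']
    · intro h; exact absurd (Finset.mem_univ _) h
  simp_rw [hcoef] at hexp
  rw [h1, hexp, Matrix.mulVec_sum]
  simp only [Finset.sum_apply]
  refine Finset.sum_congr rfl fun i _ => ?_
  rw [Matrix.mulVec_smul, hA.mulVec_eigenvectorBasis i, Pi.smul_apply, Pi.smul_apply, smul_eq_mul,
    Complex.real_smul]
  ring

/-- The quadratic form of a Hermitian matrix along its eigenvector basis: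
`⟨w, A w⟩ = Σ_i λ_i |⟨φ_i, w⟩|²`. -/
theorem hermitian_quadform_eq_sum {A : Matrix N N ℂ} (hA : A.IsHermitian) (w : N → ℂ) :
    star w ⬝ᵥ (A *ᵥ w) =
      ∑ i, (hA.eigenvalues i : ℂ) * (((‖∑ x, conj ((hA.eigenvectorBasis i) x) * w x‖ ^ 2 : ℝ)) : ℂ) := by
  have hsq : ∀ z : ℂ, (((‖z‖ ^ 2 : ℝ)) : ℂ) = z * conj z := fun z => by
    rw [Complex.mul_conj, Complex.normSq_eq_norm_sq]
  calc star w ⬝ᵥ (A *ᵥ w) = ∑ x, ∑ y, conj (w x) * (A x y * w y) := by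
        simp only [dotProduct, Matrix.mulVec, Pi.star_apply, RCLike.star_def, Finset.mul_sum]
    _ = ∑ x, ∑ y, ∑ i, (hA.eigenvalues i : ℂ) *
          ((conj ((hA.eigenvectorBasis i) y) * w y) * conj (conj ((hA.eigenvectorBasis i) x) * w x)) := by
        refine Finset.sum_congr rfl fun x _ => Finset.sum_congr rfl fun y _ => ?_
        rw [hermitian_apply_eq_sum_eigen hA x y, Finset.sum_mul, Finset.mul_sum]
        refine Finset.sum_congr rfl fun i _ => ?_
        simp only [map_mul, Complex.conj_conj]
        ring
    _ = ∑ x, ∑ i, ∑ y, (hA.eigenvalues i : ℂ) *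
          ((conj ((hA.eigenvectorBasis i) y) * w y) * conj (conj ((hA.eigenvectorBasis i) x) * w x)) :=
        Finset.sum_congr rfl fun x _ => Finset.sum_comm
    _ = ∑ i, ∑ x, ∑ y, (hA.eigenvalues i : ℂ) *
          ((conj ((hA.eigenvectorBasis i) y) * w y) * conj (conj ((hA.eigenvectorBasis i) x) * w x)) :=
        Finset.sum_comm
    _ = ∑ i, (hA.eigenvalues i : ℂ) * (((‖∑ x, conj ((hA.eigenvectorBasis i) x) * w x‖ ^ 2 : ℝ)) : ℂ) := by
        refine Finset.sum_congr rfl fun i _ => ?_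
        rw [hsq, map_sum, Finset.sum_mul_sum, Finset.mul_sum]
        rw [Finset.sum_comm]
        refine Finset.sum_congr rfl fun x _ => ?_
        rw [Finset.mul_sum]

/-- Consequence for a positive semidefinite matrix: the quadratic form dominates each single eigen-term,
`Re ⟨w, A w⟩ ≥ λ_i |⟨φ_i, w⟩|²`. -/
theorem psd_eigen_term_le {A : Matrix N N ℂ} (hA : A.PosSemidef) (w : N → ℂ) (i : N) :
    hA.1.eigenvalues i * ‖∑ x, conj ((hA.1.eigenvectorBasis i) x) * w x‖ ^ 2 ≤
      (star w ⬝ᵥ (A *ᵥ w)).re := by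
  rw [hermitian_quadform_eq_sum hA.1 w, Complex.re_sum]
  have hterm : ∀ j, ((hA.1.eigenvalues j : ℂ) *
      (((‖∑ x, conj ((hA.1.eigenvectorBasis j) x) * w x‖ ^ 2 : ℝ)) : ℂ)).re =
      hA.1.eigenvalues j * ‖∑ x, conj ((hA.1.eigenvectorBasis j) x) * w x‖ ^ 2 := by
    intro j
    rw [← Complex.ofReal_mul, Complex.ofReal_re]
  simp_rw [hterm]
  refine Finset.single_le_sum (f := fun j => hA.1.eigenvalues j *
      ‖∑ x, conj ((hA.1.eigenvectorBasis j) x) * w x‖ ^ 2) (fun j _ => ?_) (Finset.mem_univ i)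
  exact mul_nonneg (hA.eigenvalues_nonneg j) (sq_nonneg _)

/-- The trace of a positive semidefinite matrix is the (real) sum of its eigenvalues. -/
theorem psd_re_trace_eq_sum_eigenvalues {A : Matrix N N ℂ} (hA : A.PosSemidef) :
    A.trace.re = ∑ i, hA.1.eigenvalues i := by
  rw [hA.1.trace_eq_sum_eigenvalues, Complex.re_sum]
  simp

end Bridge

/-! ## Jordan splitting of a Hermitian matrix -/

section Proj

variable {N : Type*}

/-- The rank-one projector `|φ⟩⟨φ|` onto a vector, as a matrix: `(x,y) ↦ φ x · conj(φ y)`. -/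
def proj (φ : N → ℂ) : Matrix N N ℂ := Matrix.vecMulVec φ (star φ)

/-- Entries of the rank-one projector. -/
theorem proj_apply (φ : N → ℂ) (x y : N) : proj φ x y = φ x * conj (φ y) := by
  simp [proj, Matrix.vecMulVec_apply]

/-- Rank-one projectors are positive semidefinite. -/
theorem posSemidef_proj [Fintype N] (φ : N → ℂ) : (proj φ).PosSemidef :=
  Matrix.posSemidef_vecMulVec_self_star φ

/-- The trace of a rank-one projector is the squared norm of the vector. -/
theorem trace_proj [Fintype N] (φ : N → ℂ) : (proj φ).trace = ∑ x, (((‖φ x‖ ^ 2 : ℝ)) : ℂ) := by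
  simp only [Matrix.trace, Matrix.diag_apply, proj_apply]
  refine Finset.sum_congr rfl fun x _ => ?_
  rw [Complex.mul_conj, Complex.normSq_eq_norm_sq]

/-- A nonnegative real combination of rank-one projectors is positive semidefinite. -/
theorem posSemidef_sum_smul_proj [Fintype N] {ι : Type*} (s : Finset ι) (c : ι → ℝ) (hc : ∀ i, 0 ≤ c i)
    (φ : ι → N → ℂ) :
    (∑ i ∈ s, ((c i : ℝ) : ℂ) • proj (φ i)).PosSemidef := by
  refine Matrix.posSemidef_sum s fun i _ => ?_
  exact (posSemidef_proj (φ i)).smul (Complex.zero_le_real.mpr (hc i))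

end Proj

section Jordan

variable {N : Type*} [Fintype N] [DecidableEq N]

/-- **Jordan splitting.** A Hermitian matrix is the difference of two positive semidefinite matrices whose
traces add up to `Σ_i |λ_i|`, namely its positive and negative spectral parts. -/
theorem hermitian_exists_jordan {H : Matrix N N ℂ} (hH : H.IsHermitian) :
    ∃ Y Z : Matrix N N ℂ, Y.PosSemidef ∧ Z.PosSemidef ∧ H = Y - Z ∧
      (Y.trace + Z.trace).re = ∑ i, |hH.eigenvalues i| := by
  set φ := fun i => (⇑(hH.eigenvectorBasis i) : N → ℂ) with hφ
  set lam := hH.eigenvalues with hlam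
  refine ⟨∑ i, (((max (lam i) 0 : ℝ)) : ℂ) • proj (φ i), ∑ i, (((max (-lam i) 0 : ℝ)) : ℂ) • proj (φ i),
    posSemidef_sum_smul_proj _ _ (fun i => le_max_right _ _) φ,
    posSemidef_sum_smul_proj _ _ (fun i => le_max_right _ _) φ, ?_, ?_⟩
  · ext x y
    rw [hermitian_apply_eq_sum_eigen hH x y, Matrix.sub_apply, Matrix.sum_apply, Matrix.sum_apply,
      ← Finset.sum_sub_distrib]
    refine Finset.sum_congr rfl fun i _ => ?_
    simp only [Matrix.smul_apply, smul_eq_mul, proj_apply, hφ, hlam]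
    have key : ((max (hH.eigenvalues i) 0 : ℝ) : ℂ) - ((max (-hH.eigenvalues i) 0 : ℝ) : ℂ) =
        (hH.eigenvalues i : ℂ) := by
      rcases le_total 0 (hH.eigenvalues i) with h | h
      · rw [max_eq_left h, max_eq_right (by linarith)]; push_cast; ring
      · rw [max_eq_right h, max_eq_left (by linarith)]; push_cast; ring
    rw [← key]
    ring
  · rw [Matrix.trace_sum, Matrix.trace_sum, ← Finset.sum_add_distrib, Complex.re_sum]
    refine Finset.sum_congr rfl fun i _ => ?_
    rw [Matrix.trace_smul, Matrix.trace_smul, trace_proj, smul_eq_mul, smul_eq_mul, ← add_mul]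
    have hn : (∑ x, (((‖φ i x‖ ^ 2 : ℝ)) : ℂ)) = 1 := by
      have := eigvec_normSq hH i
      exact_mod_cast this
    rw [hn, mul_one, ← Complex.ofReal_add, Complex.ofReal_re]
    rcases le_total 0 (lam i) with h | h
    · rw [max_eq_left h, max_eq_right (by linarith), add_zero, abs_of_nonneg h]
    · rw [max_eq_right h, max_eq_left (by linarith), zero_add, abs_of_nonpos h]

/-- The sum `Σ_i |λ_i|` as a signed sum of diagonal quadratic forms: `Σ_i |λ_i| = Re Σ_i ε_i ⟨φ_i, H φ_i⟩` with
`ε_i = ±1` the signs of the eigenvalues. -/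
theorem hermitian_sum_abs_eigenvalues_eq {H : Matrix N N ℂ} (hH : H.IsHermitian) :
    (∑ i, |hH.eigenvalues i|) =
      (∑ i, ((if 0 ≤ hH.eigenvalues i then (1 : ℝ) else -1 : ℝ) : ℂ) *
        (star (⇑(hH.eigenvectorBasis i) : N → ℂ) ⬝ᵥ (H *ᵥ ⇑(hH.eigenvectorBasis i)))).re := by
  rw [Complex.re_sum]
  refine Finset.sum_congr rfl fun i _ => ?_
  have hq : star (⇑(hH.eigenvectorBasis i) : N → ℂ) ⬝ᵥ (H *ᵥ ⇑(hH.eigenvectorBasis i)) =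
      (hH.eigenvalues i : ℂ) := by
    have h1 := eigvec_orthonormal hH i i
    rw [if_pos rfl] at h1
    have hbb : star (⇑(hH.eigenvectorBasis i) : N → ℂ) ⬝ᵥ ⇑(hH.eigenvectorBasis i) = 1 := by
      rw [← h1, dotProduct]
      refine Finset.sum_congr rfl fun x _ => ?_
      rw [Pi.star_apply, RCLike.star_def]
    rw [hH.mulVec_eigenvectorBasis i, dotProduct_smul, hbb, Complex.real_smul, mul_one]
  rw [hq, ← Complex.ofReal_mul, Complex.ofReal_re]
  split_ifs with h
  · rw [one_mul, abs_of_nonneg h]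
  · rw [abs_of_neg (lt_of_not_ge h)]; ring

end Jordan

/-! ## Coordinate norms -/

section Nsq

variable {ι : Type*} [Fintype ι]

/-- Squared `ℓ²` norm of a coordinate vector. -/
def nsq (v : ι → ℂ) : ℝ := ∑ x, ‖v x‖ ^ 2

theorem nsq_nonneg (v : ι → ℂ) : 0 ≤ nsq v := by unfold nsq; positivity

theorem nsq_eq_norm_sq (v : ι → ℂ) : nsq v = ‖WithLp.toLp 2 v‖ ^ 2 := by
  rw [EuclideanSpace.norm_sq_eq]; rfl

theorem sqrt_nsq_eq_norm (v : ι → ℂ) : Real.sqrt (nsq v) = ‖WithLp.toLp 2 v‖ := by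
  rw [nsq_eq_norm_sq, Real.sqrt_sq (norm_nonneg _)]

/-- Triangle inequality for `√nsq` over a finite sum of vectors. -/
theorem sqrt_nsq_sum_le {κ : Type*} (s : Finset κ) (v : κ → ι → ℂ) :
    Real.sqrt (nsq (∑ j ∈ s, v j)) ≤ ∑ j ∈ s, Real.sqrt (nsq (v j)) := by
  rw [sqrt_nsq_eq_norm, WithLp.toLp_sum]
  refine (norm_sum_le s _).trans (le_of_eq ?_)
  exact Finset.sum_congr rfl fun j _ => (sqrt_nsq_eq_norm (v j)).symm

/-- Cauchy–Schwarz in coordinates: `|Σ conj(a) b|² ≤ nsq a · nsq b`. -/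
theorem norm_sum_conj_mul_sq_le (a b : ι → ℂ) :
    ‖∑ x, conj (a x) * b x‖ ^ 2 ≤ nsq a * nsq b := by
  have h1 : ‖∑ x, conj (a x) * b x‖ ≤ ∑ x, ‖a x‖ * ‖b x‖ := by
    calc ‖∑ x, conj (a x) * b x‖ ≤ ∑ x, ‖conj (a x) * b x‖ := norm_sum_le _ _
      _ = ∑ x, ‖a x‖ * ‖b x‖ := by simp_rw [norm_mul, Complex.norm_conj]
  calc ‖∑ x, conj (a x) * b x‖ ^ 2 ≤ (∑ x, ‖a x‖ * ‖b x‖) ^ 2 :=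
        pow_le_pow_left₀ (norm_nonneg _) h1 2
    _ ≤ (∑ x, ‖a x‖ ^ 2) * ∑ x, ‖b x‖ ^ 2 := Finset.sum_mul_sq_le_sq_mul_sq _ _ _
    _ = nsq a * nsq b := rfl

/-- `nsq` of a scalar multiple. -/
theorem nsq_smul (c : ℂ) (v : ι → ℂ) : nsq (c • v) = ‖c‖ ^ 2 * nsq v := by
  unfold nsq
  rw [Finset.mul_sum]
  refine Finset.sum_congr rfl fun x _ => ?_
  rw [Pi.smul_apply, smul_eq_mul, norm_mul, mul_pow]

/-- The complex form of `nsq`: `Σ conj(v) v = nsq v`. -/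
theorem sum_conj_mul_self (v : ι → ℂ) : (∑ x, conj (v x) * v x) = ((nsq v : ℝ) : ℂ) := by
  unfold nsq
  rw [Complex.ofReal_sum]
  refine Finset.sum_congr rfl fun x _ => ?_
  rw [mul_comm, Complex.mul_conj, Complex.normSq_eq_norm_sq, Complex.ofReal_pow]

end Nsq

/-! ## Orthonormal coordinate frames of `ℂ^m` (as delivered by `eigvec_orthonormal` / `eigvec_expand`) -/

section Frame

variable {m : Type*} [Fintype m]

/-- `nsq` of a combination of an orthonormal coordinate family is the sum of the squared coefficients. -/
theorem nsq_sum_smul_of_orthonormal {κ : Type*} [Fintype κ] [DecidableEq κ] (b : κ → m → ℂ)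
    (hb : ∀ j k, (∑ μ, conj (b j μ) * b k μ) = if j = k then 1 else 0) (d : κ → ℂ) :
    nsq (∑ j, d j • b j) = ∑ j, ‖d j‖ ^ 2 := by
  have hC : (∑ μ, conj ((∑ j, d j • b j) μ) * (∑ j, d j • b j) μ) = ∑ j, conj (d j) * d j := by
    calc (∑ μ, conj ((∑ j, d j • b j) μ) * (∑ j, d j • b j) μ)
        = ∑ μ, ∑ j, ∑ k, conj (d j) * d k * (conj (b j μ) * b k μ) := by
          refine Finset.sum_congr rfl fun μ _ => ?_
          have happ : (∑ j, d j • b j) μ = ∑ j, d j * b j μ := by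
            simp only [Finset.sum_apply, Pi.smul_apply, smul_eq_mul]
          rw [happ, map_sum, Finset.sum_mul]
          refine Finset.sum_congr rfl fun j _ => ?_
          rw [map_mul, Finset.mul_sum]
          refine Finset.sum_congr rfl fun k _ => ?_
          ring
      _ = ∑ j, ∑ k, conj (d j) * d k * ∑ μ, conj (b j μ) * b k μ := by
          rw [Finset.sum_comm]
          refine Finset.sum_congr rfl fun j _ => ?_
          rw [Finset.sum_comm]
          refine Finset.sum_congr rfl fun k _ => ?_
          rw [Finset.mul_sum]
      _ = ∑ j, conj (d j) * d j := by
          refine Finset.sum_congr rfl fun j _ => ?_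
          simp_rw [hb, mul_ite, mul_one, mul_zero]
          rw [Finset.sum_ite_eq]; simp
  rw [sum_conj_mul_self] at hC
  simp_rw [Complex.conj_mul'] at hC
  exact_mod_cast hC

/-- Parseval for an orthonormal coordinate family that spans: `nsq w = Σ_j |⟨b_j, w⟩|²`. -/
theorem nsq_eq_sum_of_orthonormal {κ : Type*} [Fintype κ] [DecidableEq κ] (b : κ → m → ℂ)
    (hb : ∀ j k, (∑ μ, conj (b j μ) * b k μ) = if j = k then 1 else 0)
    (w : m → ℂ) (hw : w = ∑ j, (∑ μ, conj (b j μ) * w μ) • b j) :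
    nsq w = ∑ j, ‖∑ μ, conj (b j μ) * w μ‖ ^ 2 := by
  conv_lhs => rw [hw]
  exact nsq_sum_smul_of_orthonormal b hb _

/-- Bessel in coordinates for a pairwise orthogonal family of vectors of `nsq ≤ 1` (zeros allowed):
`Σ_j |⟨y_j, x⟩|² ≤ nsq x`. -/
theorem bessel_suborthonormal {κ : Type*} [Fintype κ] (y : κ → m → ℂ)
    (hyo : ∀ j k, j ≠ k → (∑ μ, conj (y j μ) * y k μ) = 0) (hyn : ∀ j, nsq (y j) ≤ 1) (x : m → ℂ) :
    (∑ j, ‖∑ μ, conj (y j μ) * x μ‖ ^ 2) ≤ nsq x := by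
  classical
  set c : κ → ℂ := fun j => ∑ μ, conj (y j μ) * x μ with hc
  set p : m → ℂ := fun μ => ∑ j, c j * y j μ with hp
  -- the three scalar products
  have hxp : (∑ μ, conj (x μ) * p μ) = ∑ j, c j * conj (c j) := by
    calc (∑ μ, conj (x μ) * p μ) = ∑ μ, ∑ j, c j * (conj (x μ) * y j μ) := by
          refine Finset.sum_congr rfl fun μ _ => ?_
          rw [hp, Finset.mul_sum]
          exact Finset.sum_congr rfl fun j _ => by ring
      _ = ∑ j, c j * ∑ μ, conj (x μ) * y j μ := by
          rw [Finset.sum_comm]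
          exact Finset.sum_congr rfl fun j _ => by rw [Finset.mul_sum]
      _ = ∑ j, c j * conj (c j) := by
          refine Finset.sum_congr rfl fun j _ => ?_
          congr 1
          rw [hc, map_sum]
          exact Finset.sum_congr rfl fun μ _ => by rw [map_mul, Complex.conj_conj, mul_comm]
  have hpp : (∑ μ, conj (p μ) * p μ) = ∑ j, conj (c j) * c j * ((nsq (y j) : ℝ) : ℂ) := by
    calc (∑ μ, conj (p μ) * p μ) = ∑ μ, ∑ j, ∑ k, conj (c j) * c k * (conj (y j μ) * y k μ) := by
          refine Finset.sum_congr rfl fun μ _ => ?_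
          rw [hp, map_sum, Finset.sum_mul]
          refine Finset.sum_congr rfl fun j _ => ?_
          rw [map_mul, Finset.mul_sum]
          exact Finset.sum_congr rfl fun k _ => by ring
      _ = ∑ j, ∑ k, conj (c j) * c k * ∑ μ, conj (y j μ) * y k μ := by
          rw [Finset.sum_comm]
          refine Finset.sum_congr rfl fun j _ => ?_
          rw [Finset.sum_comm]
          exact Finset.sum_congr rfl fun k _ =>
            (Finset.mul_sum Finset.univ (fun μ => conj (y j μ) * y k μ) (conj (c j) * c k)).symm
      _ = ∑ j, conj (c j) * c j * ((nsq (y j) : ℝ) : ℂ) := by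
          refine Finset.sum_congr rfl fun j _ => ?_
          rw [Finset.sum_eq_single j]
          · rw [sum_conj_mul_self]
          · intro k _ hk; rw [hyo j k (Ne.symm hk), mul_zero]
          · intro h; exact absurd (Finset.mem_univ _) h
  -- 0 ≤ nsq (x - p) = nsq x - 2 S + S'  with  S' ≤ S
  have hS : (∑ j, c j * conj (c j)) = (((∑ j, ‖c j‖ ^ 2 : ℝ)) : ℂ) := by
    rw [Complex.ofReal_sum]
    exact Finset.sum_congr rfl fun j _ => by
      rw [Complex.mul_conj, Complex.normSq_eq_norm_sq, Complex.ofReal_pow]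
  have hS'le : (∑ j, ‖c j‖ ^ 2 * nsq (y j)) ≤ ∑ j, ‖c j‖ ^ 2 :=
    Finset.sum_le_sum fun j _ => by
      simpa using mul_le_mul_of_nonneg_left (hyn j) (sq_nonneg ‖c j‖)
  have hexp : nsq (x - p) = nsq x - 2 * (∑ j, ‖c j‖ ^ 2) + ∑ j, ‖c j‖ ^ 2 * nsq (y j) := by
    have h1 : (((nsq (x - p)) : ℝ) : ℂ) = ((nsq x : ℝ) : ℂ) - 2 * (((∑ j, ‖c j‖ ^ 2 : ℝ)) : ℂ) +
        (((∑ j, ‖c j‖ ^ 2 * nsq (y j) : ℝ)) : ℂ) := by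
      rw [← sum_conj_mul_self, ← sum_conj_mul_self]
      have hpx : (∑ μ, conj (p μ) * x μ) = ∑ j, c j * conj (c j) := by
        have := congrArg conj hxp
        rw [map_sum, map_sum] at this
        simp only [map_mul, Complex.conj_conj] at this
        rw [show (∑ μ, conj (p μ) * x μ) = ∑ μ, x μ * conj (p μ) from
          Finset.sum_congr rfl fun μ _ => mul_comm _ _, this]
        exact Finset.sum_congr rfl fun j _ => mul_comm _ _
      have hS'' : (∑ j, conj (c j) * c j * ((nsq (y j) : ℝ) : ℂ)) =
          (((∑ j, ‖c j‖ ^ 2 * nsq (y j) : ℝ)) : ℂ) := by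
        rw [Complex.ofReal_sum]
        exact Finset.sum_congr rfl fun j _ => by
          rw [mul_comm (conj (c j)), Complex.mul_conj, Complex.normSq_eq_norm_sq]; push_cast; ring
      calc (∑ μ, conj ((x - p) μ) * (x - p) μ)
          = (∑ μ, conj (x μ) * x μ) - (∑ μ, conj (x μ) * p μ) - (∑ μ, conj (p μ) * x μ)
              + ∑ μ, conj (p μ) * p μ := by
            simp only [Pi.sub_apply, map_sub, ← Finset.sum_sub_distrib, ← Finset.sum_add_distrib]
            exact Finset.sum_congr rfl fun μ _ => by ring
        _ = _ := by rw [hxp, hpx, hpp, hS, hS'']; ring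
    exact_mod_cast h1
  have h0 : 0 ≤ nsq (x - p) := nsq_nonneg _
  linarith

end Frame

/-! ## Partial transpose, sign operators and the key inequality -/

section Ptr

variable {n : ℕ}

/-- The PARTIAL TRANSPOSE (on the second tensor factor) of an operator on `ℂ^n ⊗ ℂ^n`:
`(ptr M) (μ,μ') (λ,λ') = M (μ,λ') (λ,μ')`. -/
def ptr (M : Matrix (Fin n × Fin n) (Fin n × Fin n) ℂ) : Matrix (Fin n × Fin n) (Fin n × Fin n) ℂ :=
  Matrix.of fun x y => M (x.1, y.2) (y.1, x.2)

theorem ptr_apply (M : Matrix (Fin n × Fin n) (Fin n × Fin n) ℂ) (x y : Fin n × Fin n) :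
    ptr M x y = M (x.1, y.2) (y.1, x.2) := rfl

/-- Reindexing a double sum over `(ℂ^n ⊗ ℂ^n)²` along the partial-transpose involution. -/
theorem sum_sum_ptr_reindex {M : Type*} [AddCommMonoid M] (F : (Fin n × Fin n) → (Fin n × Fin n) → M) :
    (∑ p, ∑ q, F p q) = ∑ x : Fin n × Fin n, ∑ y : Fin n × Fin n, F (x.1, y.2) (y.1, x.2) := by
  rw [Fintype.sum_prod_type, Fintype.sum_prod_type]
  simp_rw [Fintype.sum_prod_type (f := fun q : Fin n × Fin n => F _ q),
    Fintype.sum_prod_type (f := fun y : Fin n × Fin n => F (_, y.2) (y.1, _))]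
  -- Σ_{x1} Σ_{x2} Σ_{y1} Σ_{y2} F (x1,y2) (y1,x2)  versus  Σ_{p1} Σ_{p2} Σ_{q1} Σ_{q2} F (p1,p2) (q1,q2)
  refine Finset.sum_congr rfl fun p1 _ => ?_
  calc (∑ p2 : Fin n, ∑ q1 : Fin n, ∑ q2 : Fin n, F (p1, p2) (q1, q2))
      = ∑ p2 : Fin n, ∑ q2 : Fin n, ∑ q1 : Fin n, F (p1, p2) (q1, q2) :=
        Finset.sum_congr rfl fun p2 _ => Finset.sum_comm
    _ = ∑ q2 : Fin n, ∑ p2 : Fin n, ∑ q1 : Fin n, F (p1, p2) (q1, q2) := Finset.sum_comm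
    _ = ∑ q2 : Fin n, ∑ q1 : Fin n, ∑ p2 : Fin n, F (p1, p2) (q1, q2) :=
        Finset.sum_congr rfl fun q2 _ => Finset.sum_comm

/-- The partial transpose of a Hermitian matrix is Hermitian. -/
theorem ptr_isHermitian {M : Matrix (Fin n × Fin n) (Fin n × Fin n) ℂ} (hM : M.IsHermitian) :
    (ptr M).IsHermitian := by
  ext x y
  rw [Matrix.conjTranspose_apply, ptr_apply, ptr_apply, ← hM.apply (x.1, y.2) (y.1, x.2)]

/-- A matrix is a CONTRACTION (in coordinates). -/
def IsContr {ι : Type*} [Fintype ι] (X : Matrix ι ι ℂ) : Prop := ∀ w : ι → ℂ, nsq (X *ᵥ w) ≤ nsq w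

/-- The Frobenius mass of a contraction is at most the dimension. -/
theorem frob_le_card_of_isContr {ι : Type*} [Fintype ι] [DecidableEq ι] (X : Matrix ι ι ℂ)
    (hX : IsContr X) : (∑ x, ∑ y, ‖X x y‖ ^ 2) ≤ Fintype.card ι := by
  rw [Finset.sum_comm]
  calc (∑ y, ∑ x, ‖X x y‖ ^ 2) = ∑ y, nsq (X *ᵥ (Pi.single y 1 : ι → ℂ)) := by
        refine Finset.sum_congr rfl fun y _ => ?_
        rw [Matrix.mulVec_single_one]; rfl
    _ ≤ ∑ y, nsq (Pi.single y 1 : ι → ℂ) := Finset.sum_le_sum fun y _ => hX _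
    _ = ∑ _y : ι, (1 : ℝ) := by
        refine Finset.sum_congr rfl fun y _ => ?_
        unfold nsq
        rw [Finset.sum_eq_single y]
        · simp
        · intro x _ hx; simp [Pi.single_eq_of_ne hx]
        · intro h; exact absurd (Finset.mem_univ _) h
    _ = Fintype.card ι := by simp

/-- The SIGN OPERATOR of a Hermitian matrix: `Σ_i ε_i |u_i⟩⟨u_i|` over the eigenvector basis, with the signs
of the eigenvalues. -/
def signOp {ι : Type*} [Fintype ι] [DecidableEq ι] {H : Matrix ι ι ℂ} (hH : H.IsHermitian) : Matrix ι ι ℂ :=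
  ∑ i, ((if 0 ≤ hH.eigenvalues i then (1 : ℝ) else -1 : ℝ) : ℂ) • proj (⇑(hH.eigenvectorBasis i))

theorem signOp_apply {ι : Type*} [Fintype ι] [DecidableEq ι] {H : Matrix ι ι ℂ} (hH : H.IsHermitian) (x y : ι) :
    signOp hH x y = ∑ i, ((if 0 ≤ hH.eigenvalues i then (1 : ℝ) else -1 : ℝ) : ℂ) *
      ((hH.eigenvectorBasis i) x * conj ((hH.eigenvectorBasis i) y)) := by
  simp only [signOp, Matrix.sum_apply, Matrix.smul_apply, smul_eq_mul, proj_apply]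

theorem signOp_isHermitian {ι : Type*} [Fintype ι] [DecidableEq ι] {H : Matrix ι ι ℂ} (hH : H.IsHermitian) :
    (signOp hH).IsHermitian := by
  ext x y
  rw [Matrix.conjTranspose_apply, signOp_apply, signOp_apply, star_sum]
  refine Finset.sum_congr rfl fun i _ => ?_
  simp only [star_mul', Complex.star_def, Complex.conj_conj, Complex.conj_ofReal]
  ring

theorem signOp_mulVec {ι : Type*} [Fintype ι] [DecidableEq ι] {H : Matrix ι ι ℂ} (hH : H.IsHermitian)
    (w : ι → ℂ) :
    signOp hH *ᵥ w = ∑ i, (((if 0 ≤ hH.eigenvalues i then (1 : ℝ) else -1 : ℝ) : ℂ) *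
      ∑ y, conj ((hH.eigenvectorBasis i) y) * w y) • ⇑(hH.eigenvectorBasis i) := by
  funext x
  simp only [Matrix.mulVec, dotProduct, signOp_apply, Finset.sum_apply, Pi.smul_apply, smul_eq_mul,
    Finset.sum_mul, Finset.mul_sum]
  rw [Finset.sum_comm]
  refine Finset.sum_congr rfl fun i _ => Finset.sum_congr rfl fun y _ => ?_
  ring

theorem signOp_isContr {ι : Type*} [Fintype ι] [DecidableEq ι] {H : Matrix ι ι ℂ} (hH : H.IsHermitian) :
    IsContr (signOp hH) := by
  intro w
  rw [signOp_mulVec, nsq_sum_smul_of_orthonormal _ (eigvec_orthonormal hH),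
    nsq_eq_sum_of_orthonormal _ (eigvec_orthonormal hH) w (eigvec_expand hH w)]
  refine Finset.sum_le_sum fun i _ => ?_
  rw [norm_mul]
  have : ‖(((if 0 ≤ hH.eigenvalues i then (1 : ℝ) else -1 : ℝ)) : ℂ)‖ = 1 := by
    split_ifs <;> simp
  rw [this, one_mul]

/-- The signed sum of diagonal quadratic forms is a trace against the partial transpose of the sign operator:
`Σ_i ε_i ⟨u_i, (ptr R) u_i⟩ = Σ_{p,q} R p q · (ptr X) q p`, `X = signOp`. -/
theorem sum_sign_quadform_eq_trace {R : Matrix (Fin n × Fin n) (Fin n × Fin n) ℂ} (hH : (ptr R).IsHermitian) :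
    (∑ i, ((if 0 ≤ hH.eigenvalues i then (1 : ℝ) else -1 : ℝ) : ℂ) *
        (star (⇑(hH.eigenvectorBasis i) : Fin n × Fin n → ℂ) ⬝ᵥ (ptr R *ᵥ ⇑(hH.eigenvectorBasis i)))) =
      ∑ p, ∑ q, R p q * ptr (signOp hH) q p := by
  symm
  calc (∑ p, ∑ q, R p q * ptr (signOp hH) q p)
      = ∑ x : Fin n × Fin n, ∑ y : Fin n × Fin n, R (x.1, y.2) (y.1, x.2) * signOp hH y x := by
        rw [sum_sum_ptr_reindex (F := fun p q => R p q * ptr (signOp hH) q p)]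
        rfl
    _ = ∑ x : Fin n × Fin n, ∑ y : Fin n × Fin n, ∑ i,
          ((if 0 ≤ hH.eigenvalues i then (1 : ℝ) else -1 : ℝ) : ℂ) *
            (conj ((hH.eigenvectorBasis i) x) * (R (x.1, y.2) (y.1, x.2) * (hH.eigenvectorBasis i) y)) := by
        refine Finset.sum_congr rfl fun x _ => Finset.sum_congr rfl fun y _ => ?_
        rw [signOp_apply, Finset.mul_sum]
        exact Finset.sum_congr rfl fun i _ => by ring
    _ = ∑ x : Fin n × Fin n, ∑ i, ∑ y : Fin n × Fin n,
          ((if 0 ≤ hH.eigenvalues i then (1 : ℝ) else -1 : ℝ) : ℂ) *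
            (conj ((hH.eigenvectorBasis i) x) * (R (x.1, y.2) (y.1, x.2) * (hH.eigenvectorBasis i) y)) :=
        Finset.sum_congr rfl fun x _ => Finset.sum_comm
    _ = ∑ i, ∑ x : Fin n × Fin n, ∑ y : Fin n × Fin n,
          ((if 0 ≤ hH.eigenvalues i then (1 : ℝ) else -1 : ℝ) : ℂ) *
            (conj ((hH.eigenvectorBasis i) x) * (R (x.1, y.2) (y.1, x.2) * (hH.eigenvectorBasis i) y)) :=
        Finset.sum_comm
    _ = _ := by
        refine Finset.sum_congr rfl fun i _ => ?_
        have hq : star (⇑(hH.eigenvectorBasis i) : Fin n × Fin n → ℂ) ⬝ᵥ (ptr R *ᵥ ⇑(hH.eigenvectorBasis i))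
            = ∑ x : Fin n × Fin n, ∑ y : Fin n × Fin n,
                conj ((hH.eigenvectorBasis i) x) * (R (x.1, y.2) (y.1, x.2) * (hH.eigenvectorBasis i) y) := by
          unfold dotProduct Matrix.mulVec
          refine Finset.sum_congr rfl fun x _ => ?_
          rw [Pi.star_apply, RCLike.star_def, dotProduct, Finset.mul_sum]
          rfl
        rw [hq, Finset.mul_sum]
        refine Finset.sum_congr rfl fun x _ => ?_
        rw [Finset.mul_sum]

/-- Rows of a vector of `ℂ^n ⊗ ℂ^n` in a coordinate frame `b` of the first factor:
`row b φ j = (μ' ↦ Σ_μ conj(b j μ) φ(μ,μ'))`. -/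
def row (b : Fin n → Fin n → ℂ) (φ : Fin n × Fin n → ℂ) (j : Fin n) : Fin n → ℂ :=
  fun μ' => ∑ μ, conj (b j μ) * φ (μ, μ')

/-- **Key inequality.** For a Hermitian contraction `X` on `ℂ^n ⊗ ℂ^n`, any vector `φ` and any orthonormal
coordinate frame `b` of the first factor: `nsq ((ptr X) φ) ≤ n · (Σ_j ‖row_j φ‖)²`. -/
theorem nsq_ptr_mulVec_le (X : Matrix (Fin n × Fin n) (Fin n × Fin n) ℂ) (hXh : X.IsHermitian)
    (hXc : IsContr X) (b : Fin n → Fin n → ℂ)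
    (hb : ∀ j k, (∑ μ, conj (b j μ) * b k μ) = if j = k then 1 else 0)
    (hbc : ∀ w : Fin n → ℂ, w = ∑ j, (∑ μ, conj (b j μ) * w μ) • b j)
    (φ : Fin n × Fin n → ℂ) :
    nsq (ptr X *ᵥ φ) ≤ n * (∑ j, Real.sqrt (nsq (row b φ j))) ^ 2 := by
  classical
  -- the pieces v_{j,μ}
  set v : Fin n → Fin n → Fin n → ℂ :=
    fun j μ μ' => ∑ l : Fin n, ∑ l' : Fin n, X (μ, l') (l, μ') * (b j l * row b φ j l') with hv
  -- (2) slices of (ptr X) φ are sums of the pieces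
  have hslice : ∀ μ μ', (ptr X *ᵥ φ) (μ, μ') = ∑ j, v j μ μ' := by
    intro μ μ'
    have hφ : ∀ l l', φ (l, l') = ∑ j, b j l * row b φ j l' := by
      intro l l'
      have h := congrFun (hbc fun l => φ (l, l')) l
      simp only [Finset.sum_apply, Pi.smul_apply, smul_eq_mul] at h
      rw [h]
      exact Finset.sum_congr rfl fun j _ => by rw [row, mul_comm]
    calc (ptr X *ᵥ φ) (μ, μ') = ∑ p : Fin n × Fin n, X (μ, p.2) (p.1, μ') * φ p := by
          simp only [Matrix.mulVec, dotProduct, ptr_apply]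
      _ = ∑ l : Fin n, ∑ l' : Fin n, ∑ j, X (μ, l') (l, μ') * (b j l * row b φ j l') := by
          rw [Fintype.sum_prod_type]
          refine Finset.sum_congr rfl fun l _ => Finset.sum_congr rfl fun l' _ => ?_
          rw [hφ l l', Finset.mul_sum]
      _ = ∑ l : Fin n, ∑ j, ∑ l' : Fin n, X (μ, l') (l, μ') * (b j l * row b φ j l') :=
          Finset.sum_congr rfl fun l _ => Finset.sum_comm
      _ = ∑ j, ∑ l : Fin n, ∑ l' : Fin n, X (μ, l') (l, μ') * (b j l * row b φ j l') := Finset.sum_comm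
      _ = ∑ j, v j μ μ' := rfl
  -- (3) each piece is bounded by the row: nsq (v j μ) ≤ nsq (row j)
  have hpiece : ∀ j μ, nsq (v j μ) ≤ nsq (row b φ j) := by
    intro j μ
    set r := row b φ j with hr
    set w : Fin n × Fin n → ℂ := fun a => if a.1 = μ then conj (r a.2) else 0 with hw
    have hXw : ∀ l μ', (X *ᵥ w) (l, μ') = ∑ l' : Fin n, X (l, μ') (μ, l') * conj (r l') := by
      intro l μ'
      simp only [Matrix.mulVec, dotProduct, hw]
      rw [Fintype.sum_prod_type]
      rw [Finset.sum_eq_single μ]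
      · simp
      · intro a _ ha
        simp [ha]
      · intro h; exact absurd (Finset.mem_univ _) h
    have hvw : ∀ μ', v j μ μ' = ∑ l : Fin n, conj (conj (b j l)) * conj ((X *ᵥ w) (l, μ')) := by
      intro μ'
      simp only [hv, hXw, map_sum, map_mul, Complex.conj_conj, Finset.mul_sum]
      refine Finset.sum_congr rfl fun l _ => Finset.sum_congr rfl fun l' _ => ?_
      rw [← hXh.apply (μ, l') (l, μ'), RCLike.star_def]
      ring
    have hcs : ∀ μ', ‖v j μ μ'‖ ^ 2 ≤ ∑ l : Fin n, ‖(X *ᵥ w) (l, μ')‖ ^ 2 := by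
      intro μ'
      rw [hvw μ']
      have h := norm_sum_conj_mul_sq_le (fun l => conj (b j l)) (fun l => conj ((X *ᵥ w) (l, μ')))
      have hb1 : nsq (fun l => conj (b j l)) = 1 := by
        have := nsq_sum_smul_of_orthonormal b hb (Pi.single j 1)
        rw [show (∑ k, (Pi.single j 1 : Fin n → ℂ) k • b k) = b j from ?_] at this
        · unfold nsq at this ⊢
          simp_rw [Complex.norm_conj]
          rw [this, Finset.sum_eq_single j]
          · simp
          · intro k _ hk; simp [Pi.single_eq_of_ne hk]
          · intro h'; exact absurd (Finset.mem_univ _) h'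
        · rw [Finset.sum_eq_single j]
          · simp
          · intro k _ hk; simp [Pi.single_eq_of_ne hk]
          · intro h'; exact absurd (Finset.mem_univ _) h'
      rw [hb1, one_mul] at h
      refine h.trans (le_of_eq ?_)
      unfold nsq
      simp_rw [Complex.norm_conj]
    calc nsq (v j μ) = ∑ μ', ‖v j μ μ'‖ ^ 2 := rfl
      _ ≤ ∑ μ', ∑ l : Fin n, ‖(X *ᵥ w) (l, μ')‖ ^ 2 := Finset.sum_le_sum fun μ' _ => hcs μ'
      _ = nsq (X *ᵥ w) := by
          unfold nsq
          rw [Fintype.sum_prod_type, Finset.sum_comm]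
      _ ≤ nsq w := hXc w
      _ = nsq r := by
          unfold nsq
          rw [Fintype.sum_prod_type, Finset.sum_eq_single μ]
          · simp [hw]
          · intro a _ ha
            simp [hw, ha]
          · intro h; exact absurd (Finset.mem_univ _) h
  -- (4) triangle inequality per slice, then sum over μ
  have hsl : ∀ μ, nsq (fun μ' => (ptr X *ᵥ φ) (μ, μ')) ≤ (∑ j, Real.sqrt (nsq (row b φ j))) ^ 2 := by
    intro μ
    have hfun : (fun μ' => (ptr X *ᵥ φ) (μ, μ')) = ∑ j, v j μ := by
      funext μ'; rw [hslice, Finset.sum_apply]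
    rw [hfun, ← Real.sqrt_le_sqrt_iff (by positivity), Real.sqrt_sq (by positivity)]
    refine (sqrt_nsq_sum_le _ _).trans (Finset.sum_le_sum fun j _ => ?_)
    exact Real.sqrt_le_sqrt (hpiece j μ)
  calc nsq (ptr X *ᵥ φ) = ∑ μ, nsq (fun μ' => (ptr X *ᵥ φ) (μ, μ')) := by
        unfold nsq; rw [Fintype.sum_prod_type]
    _ ≤ ∑ _μ : Fin n, (∑ j, Real.sqrt (nsq (row b φ j))) ^ 2 := Finset.sum_le_sum fun μ _ => hsl μ
    _ = n * (∑ j, Real.sqrt (nsq (row b φ j))) ^ 2 := by simp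

end Ptr

/-! ## The sub-unitary witness of a vector (Schmidt rows via the spectral theorem of `Φ Φᴴ`) -/

section Witness

variable {n : ℕ}

/-- `Ψ ∈ ℂ^n ⊗ ℂ^n` is SUB-UNITARY: the matrix `(m,m') ↦ conj Ψ(m,m')` is a contraction. -/
def IsSubunitary (Ψ : Fin n × Fin n → ℂ) : Prop :=
  ∀ x : Fin n → ℂ, (∑ m, ‖∑ m', conj (Ψ (m, m')) * x m'‖ ^ 2) ≤ nsq x

theorem isSubunitary_zero : IsSubunitary (0 : Fin n × Fin n → ℂ) := by
  intro x; simp [nsq_nonneg]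

/-- **Sub-unitary witness.** Every `φ ∈ ℂ^n ⊗ ℂ^n` admits a sub-unitary `Ψ` with `⟨Ψ, φ⟩ = ρ ≥ 0` real and
`nsq ((ptr X) φ) ≤ n ρ²` for every Hermitian contraction `X` (so `ρ` is the sum of the Schmidt coefficients
of `φ`, obtained here from the eigenvector basis of `Φ Φᴴ` without a singular value decomposition). -/
theorem exists_subunitary_witness (φ : Fin n × Fin n → ℂ) :
    ∃ Ψ : Fin n × Fin n → ℂ, IsSubunitary Ψ ∧ ∃ ρ : ℝ, 0 ≤ ρ ∧
      (∑ x, conj (Ψ x) * φ x) = (ρ : ℂ) ∧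
      ∀ X : Matrix (Fin n × Fin n) (Fin n × Fin n) ℂ, X.IsHermitian → IsContr X →
        nsq (ptr X *ᵥ φ) ≤ n * ρ ^ 2 := by
  classical
  -- the Gram matrix of the rows and its eigenvector basis
  set Φ : Matrix (Fin n) (Fin n) ℂ := Matrix.of fun l l' => φ (l, l') with hΦ
  have hG : (Φ * Φᴴ).IsHermitian := Matrix.isHermitian_mul_conjTranspose_self Φ
  set b : Fin n → Fin n → ℂ := fun j => (⇑(hG.eigenvectorBasis j) : Fin n → ℂ) with hbdef
  have hb : ∀ j k, (∑ μ, conj (b j μ) * b k μ) = if j = k then 1 else 0 := eigvec_orthonormal hG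
  have hbc : ∀ w : Fin n → ℂ, w = ∑ j, (∑ μ, conj (b j μ) * w μ) • b j := eigvec_expand hG
  set r : Fin n → Fin n → ℂ := row b φ with hrdef
  -- rows are pairwise orthogonal (eigenvectors of Φ Φᴴ)
  have hGapply : ∀ κ l, (Φ * Φᴴ) κ l = ∑ μ', φ (κ, μ') * conj (φ (l, μ')) := by
    intro κ l
    simp only [Matrix.mul_apply, Matrix.conjTranspose_apply, RCLike.star_def, hΦ, Matrix.of_apply]
  have hrow_orth : ∀ j k, (∑ μ', conj (r j μ') * r k μ') =
      (hG.eigenvalues k : ℂ) * ∑ κ, conj (b j κ) * b k κ := by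
    intro j k
    calc (∑ μ', conj (r j μ') * r k μ')
        = ∑ μ', ∑ l, ∑ κ, b j l * conj (b k κ) * (φ (κ, μ') * conj (φ (l, μ'))) := by
          refine Finset.sum_congr rfl fun μ' _ => ?_
          simp only [hrdef, row, map_sum, map_mul, Complex.conj_conj, Finset.sum_mul]
          refine Finset.sum_congr rfl fun l _ => ?_
          rw [Finset.mul_sum]
          exact Finset.sum_congr rfl fun κ _ => by ring
      _ = ∑ l, ∑ κ, b j l * conj (b k κ) * (Φ * Φᴴ) κ l := by
          rw [Finset.sum_comm]
          refine Finset.sum_congr rfl fun l _ => ?_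
          rw [Finset.sum_comm]
          refine Finset.sum_congr rfl fun κ _ => ?_
          rw [hGapply, Finset.mul_sum]
      _ = ∑ κ, conj (b k κ) * ∑ l, (Φ * Φᴴ) κ l * b j l := by
          rw [Finset.sum_comm]
          refine Finset.sum_congr rfl fun κ _ => ?_
          rw [Finset.mul_sum]
          exact Finset.sum_congr rfl fun l _ => by ring
      _ = ∑ κ, conj (b k κ) * ((hG.eigenvalues j : ℂ) * b j κ) := by
          refine Finset.sum_congr rfl fun κ _ => ?_
          have h := congrFun (hG.mulVec_eigenvectorBasis j) κ
          simp only [Matrix.mulVec, dotProduct, Pi.smul_apply, Complex.real_smul] at h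
          rw [h]
      _ = (hG.eigenvalues j : ℂ) * ∑ κ, conj (b k κ) * b j κ := by
          rw [Finset.mul_sum]; exact Finset.sum_congr rfl fun κ _ => by ring
      _ = (hG.eigenvalues k : ℂ) * ∑ κ, conj (b j κ) * b k κ := by
          rw [hb k j, hb j k]
          by_cases hjk : j = k
          · subst hjk; simp
          · rw [if_neg (Ne.symm hjk), if_neg hjk, mul_zero, mul_zero]
  -- normalised rows
  set sj : Fin n → ℝ := fun j => Real.sqrt (nsq (r j)) with hsj
  set y : Fin n → Fin n → ℂ := fun j => ((sj j)⁻¹ : ℂ) • r j with hydef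
  have hy_orth : ∀ j k, j ≠ k → (∑ μ, conj (y j μ) * y k μ) = 0 := by
    intro j k hjk
    have h0 : (∑ μ', conj (r j μ') * r k μ') = 0 := by rw [hrow_orth, hb, if_neg hjk, mul_zero]
    calc (∑ μ, conj (y j μ) * y k μ) = conj ((sj j)⁻¹ : ℂ) * ((sj k)⁻¹ : ℂ) * ∑ μ', conj (r j μ') * r k μ' := by
          rw [Finset.mul_sum]
          refine Finset.sum_congr rfl fun μ _ => ?_
          simp only [hydef, Pi.smul_apply, smul_eq_mul, map_mul]
          ring
      _ = 0 := by rw [h0, mul_zero]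
  have hy_nsq : ∀ j, nsq (y j) ≤ 1 := by
    intro j
    rw [hydef]
    dsimp only
    rw [nsq_smul, norm_inv, Complex.norm_real, Real.norm_eq_abs, abs_of_nonneg (Real.sqrt_nonneg _)]
    rcases eq_or_lt_of_le (nsq_nonneg (r j)) with h0 | hpos
    · rw [← h0]; simp
    · rw [inv_pow, Real.sq_sqrt hpos.le]
      exact le_of_eq (inv_mul_cancel₀ hpos.ne')
  -- the witness
  set Ψ : Fin n × Fin n → ℂ := fun x => ∑ j, b j x.1 * y j x.2 with hΨ
  refine ⟨Ψ, ?_, ∑ j, sj j, Finset.sum_nonneg fun j _ => Real.sqrt_nonneg _, ?_, ?_⟩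
  · -- sub-unitary
    intro x
    set c : Fin n → ℂ := fun j => ∑ m', conj (y j m') * x m' with hc
    have hcol : ∀ m, (∑ m', conj (Ψ (m, m')) * x m') = (∑ j, c j • fun μ => conj (b j μ)) m := by
      intro m
      simp only [hΨ, Finset.sum_apply, Pi.smul_apply, smul_eq_mul, map_sum, map_mul, Finset.sum_mul, hc]
      rw [Finset.sum_comm]
      refine Finset.sum_congr rfl fun j _ => ?_
      exact Finset.sum_congr rfl fun m' _ => by ring
    have hbconj : ∀ j k, (∑ μ, conj (conj (b j μ)) * conj (b k μ)) = if j = k then 1 else 0 := by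
      intro j k
      rw [show (∑ μ, conj (conj (b j μ)) * conj (b k μ)) = conj (∑ μ, conj (b j μ) * b k μ) by
        rw [map_sum]; exact Finset.sum_congr rfl fun μ _ => by rw [map_mul], hb j k]
      split_ifs <;> simp
    calc (∑ m, ‖∑ m', conj (Ψ (m, m')) * x m'‖ ^ 2) = nsq (∑ j, c j • fun μ => conj (b j μ)) := by
          unfold nsq; exact Finset.sum_congr rfl fun m _ => by rw [hcol m]
      _ = ∑ j, ‖c j‖ ^ 2 := nsq_sum_smul_of_orthonormal _ hbconj c
      _ ≤ nsq x := bessel_suborthonormal y hy_orth hy_nsq x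
  · -- ⟨Ψ, φ⟩ = Σ_j ‖r_j‖
    calc (∑ x, conj (Ψ x) * φ x) = ∑ μ, ∑ μ', ∑ j, conj (y j μ') * (conj (b j μ) * φ (μ, μ')) := by
          rw [Fintype.sum_prod_type]
          refine Finset.sum_congr rfl fun μ _ => Finset.sum_congr rfl fun μ' _ => ?_
          simp only [hΨ, map_sum, map_mul, Finset.sum_mul]
          exact Finset.sum_congr rfl fun j _ => by ring
      _ = ∑ j, ∑ μ', conj (y j μ') * ∑ μ, conj (b j μ) * φ (μ, μ') := by
          calc (∑ μ, ∑ μ', ∑ j, conj (y j μ') * (conj (b j μ) * φ (μ, μ')))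
              = ∑ μ, ∑ j, ∑ μ', conj (y j μ') * (conj (b j μ) * φ (μ, μ')) :=
                Finset.sum_congr rfl fun μ _ => Finset.sum_comm
            _ = ∑ j, ∑ μ, ∑ μ', conj (y j μ') * (conj (b j μ) * φ (μ, μ')) := Finset.sum_comm
            _ = ∑ j, ∑ μ', ∑ μ, conj (y j μ') * (conj (b j μ) * φ (μ, μ')) :=
                Finset.sum_congr rfl fun j _ => Finset.sum_comm
            _ = _ := Finset.sum_congr rfl fun j _ => Finset.sum_congr rfl fun μ' _ => by rw [Finset.mul_sum]
      _ = ∑ j, ((sj j : ℝ) : ℂ) := by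
          refine Finset.sum_congr rfl fun j _ => ?_
          have hrj : ∀ μ', (∑ μ, conj (b j μ) * φ (μ, μ')) = r j μ' := fun μ' => rfl
          simp_rw [hrj]
          calc (∑ μ', conj (y j μ') * r j μ') = conj ((sj j)⁻¹ : ℂ) * ∑ μ', conj (r j μ') * r j μ' := by
                rw [Finset.mul_sum]
                refine Finset.sum_congr rfl fun μ' _ => ?_
                simp only [hydef, Pi.smul_apply, smul_eq_mul, map_mul]
                ring
            _ = ((sj j : ℝ) : ℂ) := by
                rw [sum_conj_mul_self, ← Complex.ofReal_inv, Complex.conj_ofReal, ← Complex.ofReal_mul]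
                congr 1
                rw [hsj]
                dsimp only
                have hs := nsq_nonneg (r j)
                rcases eq_or_lt_of_le hs with h0 | hpos
                · rw [← h0]; simp
                · have hne : Real.sqrt (nsq (r j)) ≠ 0 := (Real.sqrt_pos.mpr hpos).ne'
                  rw [inv_mul_eq_iff_eq_mul₀ hne]
                  exact (Real.mul_self_sqrt hs).symm
      _ = ((∑ j, sj j : ℝ) : ℂ) := by rw [Complex.ofReal_sum]
  · -- the key inequality
    intro X hXh hXc
    exact nsq_ptr_mulVec_le X hXh hXc b hb hbc φ

end Witness

/-! ## The trace-norm bound for the partial transpose of a positive semidefinite operator -/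

section Bound

variable {n : ℕ}

/-- Frobenius mass of a weighted sum of eigen-projectors over a sub-family: `Σ_{p,q} |Σ_{i∈Λ} μ_i φ_i(p) conj φ_i(q)|² =
Σ_{i∈Λ} μ_i²`. -/
theorem frob_partial_eigen {ι : Type*} [Fintype ι] [DecidableEq ι] {A : Matrix ι ι ℂ} (hA : A.IsHermitian)
    (Λ : Finset ι) :
    (∑ p, ∑ q, ‖∑ i ∈ Λ, (hA.eigenvalues i : ℂ) * ((hA.eigenvectorBasis i) p * conj ((hA.eigenvectorBasis i) q))‖ ^ 2)
      = ∑ i ∈ Λ, hA.eigenvalues i ^ 2 := by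
  set φ := fun i => (⇑(hA.eigenvectorBasis i) : ι → ℂ) with hφ
  set μ := hA.eigenvalues with hμ
  have horth := eigvec_orthonormal hA
  -- complex form
  have hC : (∑ p, ∑ q, conj (∑ i ∈ Λ, (μ i : ℂ) * (φ i p * conj (φ i q))) *
      (∑ i ∈ Λ, (μ i : ℂ) * (φ i p * conj (φ i q)))) = ∑ i ∈ Λ, ((μ i ^ 2 : ℝ) : ℂ) := by
    calc (∑ p, ∑ q, conj (∑ i ∈ Λ, (μ i : ℂ) * (φ i p * conj (φ i q))) *
          (∑ i ∈ Λ, (μ i : ℂ) * (φ i p * conj (φ i q))))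
        = ∑ p, ∑ q, ∑ i ∈ Λ, ∑ i' ∈ Λ, (μ i : ℂ) * (μ i' : ℂ) *
            ((conj (φ i p) * φ i' p) * (conj (φ i' q) * φ i q)) := by
          refine Finset.sum_congr rfl fun p _ => Finset.sum_congr rfl fun q _ => ?_
          rw [map_sum, Finset.sum_mul]
          refine Finset.sum_congr rfl fun i _ => ?_
          rw [Finset.mul_sum]
          refine Finset.sum_congr rfl fun i' _ => ?_
          simp only [map_mul, Complex.conj_conj, Complex.conj_ofReal]
          ring
      _ = ∑ i ∈ Λ, ∑ i' ∈ Λ, (μ i : ℂ) * (μ i' : ℂ) *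
            ((∑ p, conj (φ i p) * φ i' p) * ∑ q, conj (φ i' q) * φ i q) := by
          calc (∑ p, ∑ q, ∑ i ∈ Λ, ∑ i' ∈ Λ, (μ i : ℂ) * (μ i' : ℂ) *
                ((conj (φ i p) * φ i' p) * (conj (φ i' q) * φ i q)))
              = ∑ p, ∑ i ∈ Λ, ∑ q, ∑ i' ∈ Λ, (μ i : ℂ) * (μ i' : ℂ) *
                  ((conj (φ i p) * φ i' p) * (conj (φ i' q) * φ i q)) :=
                Finset.sum_congr rfl fun p _ => Finset.sum_comm
            _ = ∑ i ∈ Λ, ∑ p, ∑ q, ∑ i' ∈ Λ, (μ i : ℂ) * (μ i' : ℂ) *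
                  ((conj (φ i p) * φ i' p) * (conj (φ i' q) * φ i q)) := Finset.sum_comm
            _ = ∑ i ∈ Λ, ∑ p, ∑ i' ∈ Λ, ∑ q, (μ i : ℂ) * (μ i' : ℂ) *
                  ((conj (φ i p) * φ i' p) * (conj (φ i' q) * φ i q)) :=
                Finset.sum_congr rfl fun i _ => Finset.sum_congr rfl fun p _ => Finset.sum_comm
            _ = ∑ i ∈ Λ, ∑ i' ∈ Λ, ∑ p, ∑ q, (μ i : ℂ) * (μ i' : ℂ) *
                  ((conj (φ i p) * φ i' p) * (conj (φ i' q) * φ i q)) :=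
                Finset.sum_congr rfl fun i _ => Finset.sum_comm
            _ = _ := by
                refine Finset.sum_congr rfl fun i _ => Finset.sum_congr rfl fun i' _ => ?_
                rw [Finset.sum_mul_sum, Finset.mul_sum]
                refine Finset.sum_congr rfl fun p _ => ?_
                rw [Finset.mul_sum]
      _ = ∑ i ∈ Λ, ((μ i ^ 2 : ℝ) : ℂ) := by
          refine Finset.sum_congr rfl fun i hi => ?_
          rw [Finset.sum_eq_single_of_mem i hi]
          · rw [horth i i, if_pos rfl]
            all_goals (push_cast; ring)
          · intro i' _ hi'
            rw [horth i i', if_neg (Ne.symm hi'), zero_mul, mul_zero]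
  have hre : ∀ z : ℂ, conj z * z = ((‖z‖ ^ 2 : ℝ) : ℂ) := fun z => by
    rw [mul_comm, Complex.mul_conj, Complex.normSq_eq_norm_sq, Complex.ofReal_pow]
  simp_rw [hre] at hC
  exact_mod_cast hC

/-- **Trace-norm bound.** Let `R ⪰ 0` on `ℂ^n ⊗ ℂ^n` and suppose `Re ⟨Ψ, R Ψ⟩ ≤ M` for every sub-unitary `Ψ`.
Then for every `θ > 0` the partial transpose splits as `ptr R = Y − Z` with `Y, Z ⪰ 0` and
`tr Y + tr Z ≤ n √(t M / θ) + t √(n θ)`, `t = tr R`. (Optimising `θ` gives `‖(ptr R)‖₁⁴ ≤ 16 n³ t³ M`.) -/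
theorem ptr_traceNorm_bound (R : Matrix (Fin n × Fin n) (Fin n × Fin n) ℂ) (hR : R.PosSemidef) {M θ : ℝ}
    (hθ : 0 < θ) (hM : ∀ Ψ : Fin n × Fin n → ℂ, IsSubunitary Ψ → (star Ψ ⬝ᵥ (R *ᵥ Ψ)).re ≤ M) :
    ∃ Y Z : Matrix (Fin n × Fin n) (Fin n × Fin n) ℂ, Y.PosSemidef ∧ Z.PosSemidef ∧ ptr R = Y - Z ∧
      (Y.trace + Z.trace).re ≤ n * Real.sqrt (R.trace.re * M / θ) + R.trace.re * Real.sqrt (n * θ) := by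
  classical
  have hM0 : 0 ≤ M := by
    have h := hM 0 isSubunitary_zero
    simpa using h
  have hH : (ptr R).IsHermitian := ptr_isHermitian hR.1
  obtain ⟨Y, Z, hY, hZ, hsplit, htr⟩ := hermitian_exists_jordan hH
  refine ⟨Y, Z, hY, hZ, hsplit, ?_⟩
  rw [htr, hermitian_sum_abs_eigenvalues_eq hH, sum_sign_quadform_eq_trace hH]
  -- notation
  set X := signOp hH with hXdef
  set K := ptr X with hKdef
  have hXh : X.IsHermitian := signOp_isHermitian hH
  have hXc : IsContr X := signOp_isContr hH
  set μ := hR.1.eigenvalues with hμ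
  set φ := fun i => (⇑(hR.1.eigenvectorBasis i) : Fin n × Fin n → ℂ) with hφ
  have hμnn : ∀ i, 0 ≤ μ i := hR.eigenvalues_nonneg
  have horth := eigvec_orthonormal hR.1
  set t := R.trace.re with ht
  have htsum : t = ∑ i, μ i := psd_re_trace_eq_sum_eigenvalues hR
  -- T_i := ⟨φ_i, K φ_i⟩ and the expansion of tr(R K) along the eigenvectors of R
  set T : Fin n × Fin n → ℂ := fun i => star (φ i) ⬝ᵥ (K *ᵥ φ i) with hT
  have hexpand : (∑ p, ∑ q, R p q * K q p) = ∑ i, (μ i : ℂ) * T i := by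
    calc (∑ p, ∑ q, R p q * K q p)
        = ∑ p, ∑ q, ∑ i, (μ i : ℂ) * (conj (φ i q) * (K q p * φ i p)) := by
          refine Finset.sum_congr rfl fun p _ => Finset.sum_congr rfl fun q _ => ?_
          rw [hermitian_apply_eq_sum_eigen hR.1 p q, Finset.sum_mul]
          exact Finset.sum_congr rfl fun i _ => by ring
      _ = ∑ p, ∑ i, ∑ q, (μ i : ℂ) * (conj (φ i q) * (K q p * φ i p)) :=
          Finset.sum_congr rfl fun p _ => Finset.sum_comm
      _ = ∑ i, ∑ p, ∑ q, (μ i : ℂ) * (conj (φ i q) * (K q p * φ i p)) := Finset.sum_comm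
      _ = ∑ i, (μ i : ℂ) * T i := by
          refine Finset.sum_congr rfl fun i _ => ?_
          rw [hT]
          dsimp only
          rw [dotProduct, Finset.mul_sum, Finset.sum_comm]
          refine Finset.sum_congr rfl fun q _ => ?_
          rw [Pi.star_apply, RCLike.star_def, Matrix.mulVec, dotProduct, Finset.mul_sum, Finset.mul_sum]
  rw [hexpand]
  -- the witnesses Ψ_i, ρ_i
  have hw : ∀ i, ∃ Ψ : Fin n × Fin n → ℂ, IsSubunitary Ψ ∧ ∃ ρ : ℝ, 0 ≤ ρ ∧
      (∑ x, conj (Ψ x) * φ i x) = (ρ : ℂ) ∧ nsq (K *ᵥ φ i) ≤ n * ρ ^ 2 := by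
    intro i
    obtain ⟨Ψ, hΨ, ρ, hρ, hov, hkey⟩ := exists_subunitary_witness (φ i)
    exact ⟨Ψ, hΨ, ρ, hρ, hov, hkey X hXh hXc⟩
  choose Ψ hΨ ρ hρ hov hkey using hw
  -- (a) |T_i| ≤ √n ρ_i
  have hTi : ∀ i, ‖T i‖ ≤ Real.sqrt n * ρ i := by
    intro i
    have hcs := norm_sum_conj_mul_sq_le (φ i) (K *ᵥ φ i)
    have hn1 : nsq (φ i) = 1 := eigvec_normSq hR.1 i
    rw [hn1, one_mul] at hcs
    have hT' : T i = ∑ x, conj (φ i x) * (K *ᵥ φ i) x := by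
      rw [hT]; dsimp only; rw [dotProduct]
      exact Finset.sum_congr rfl fun x _ => by rw [Pi.star_apply, RCLike.star_def]
    rw [hT']
    have h1 : ‖∑ x, conj (φ i x) * (K *ᵥ φ i) x‖ ≤ Real.sqrt (nsq (K *ᵥ φ i)) := by
      rw [← Real.sqrt_sq (norm_nonneg _)]
      exact Real.sqrt_le_sqrt hcs
    refine h1.trans ?_
    rw [← Real.sqrt_sq (hρ i), ← Real.sqrt_mul (Nat.cast_nonneg n)]
    exact Real.sqrt_le_sqrt (hkey i)
  -- (b) μ_i ρ_i² ≤ M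
  have hμρ : ∀ i, μ i * ρ i ^ 2 ≤ M := by
    intro i
    have h1 := psd_eigen_term_le hR (Ψ i) i
    have h2 : ‖∑ x, conj (φ i x) * Ψ i x‖ = ρ i := by
      have : (∑ x, conj (φ i x) * Ψ i x) = conj (∑ x, conj (Ψ i x) * φ i x) := by
        rw [map_sum]; exact Finset.sum_congr rfl fun x _ => by rw [map_mul, Complex.conj_conj, mul_comm]
      rw [this, hov i, Complex.conj_ofReal, Complex.norm_real, Real.norm_eq_abs, abs_of_nonneg (hρ i)]
    simp only [hμ, hφ] at h1 h2 ⊢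
    rw [h2] at h1
    exact h1.trans (hM (Ψ i) (hΨ i))
  -- split the index set
  set P : Fin n × Fin n → Prop := fun i => θ ≤ ρ i ^ 2 with hP
  set Λ := Finset.univ.filter P with hΛ
  rw [Complex.re_sum, ← Finset.sum_filter_add_sum_filter_not Finset.univ P]
  have hre_i : ∀ i, ((μ i : ℂ) * T i).re = μ i * (T i).re := fun i => by
    rw [Complex.re_ofReal_mul]
  -- TAIL
  have htail : (∑ i ∈ Finset.univ.filter (fun i => ¬ P i), ((μ i : ℂ) * T i).re) ≤ t * Real.sqrt (n * θ) := by
    calc (∑ i ∈ Finset.univ.filter (fun i => ¬ P i), ((μ i : ℂ) * T i).re)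
        ≤ ∑ i ∈ Finset.univ.filter (fun i => ¬ P i), μ i * Real.sqrt (n * θ) := by
          refine Finset.sum_le_sum fun i hi => ?_
          rw [Finset.mem_filter] at hi
          rw [hre_i]
          refine mul_le_mul_of_nonneg_left ?_ (hμnn i)
          refine (Complex.re_le_norm _).trans ((hTi i).trans ?_)
          rw [Real.sqrt_mul (Nat.cast_nonneg n)]
          refine mul_le_mul_of_nonneg_left ?_ (Real.sqrt_nonneg _)
          rw [← Real.sqrt_sq (hρ i)]
          exact Real.sqrt_le_sqrt (le_of_lt (lt_of_not_ge hi.2))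
      _ ≤ ∑ i, μ i * Real.sqrt (n * θ) :=
          Finset.sum_le_sum_of_subset_of_nonneg (Finset.filter_subset _ _)
            (fun i _ _ => mul_nonneg (hμnn i) (Real.sqrt_nonneg _))
      _ = t * Real.sqrt (n * θ) := by rw [← Finset.sum_mul, ← htsum]
  -- HEAD
  have hhead : (∑ i ∈ Λ, ((μ i : ℂ) * T i).re) ≤ n * Real.sqrt (t * M / θ) := by
    -- as one trace against R_Λ
    set RΛ : (Fin n × Fin n) → (Fin n × Fin n) → ℂ :=
      fun p q => ∑ i ∈ Λ, (μ i : ℂ) * (φ i p * conj (φ i q)) with hRΛ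
    have hsumT : (∑ i ∈ Λ, (μ i : ℂ) * T i) = ∑ q, ∑ p, K q p * RΛ p q := by
      symm
      calc (∑ q, ∑ p, K q p * RΛ p q) = ∑ q, ∑ p, ∑ i ∈ Λ, (μ i : ℂ) * (conj (φ i q) * (K q p * φ i p)) := by
            refine Finset.sum_congr rfl fun q _ => Finset.sum_congr rfl fun p _ => ?_
            rw [hRΛ]; dsimp only; rw [Finset.mul_sum]
            exact Finset.sum_congr rfl fun i _ => by ring
        _ = ∑ q, ∑ i ∈ Λ, ∑ p, (μ i : ℂ) * (conj (φ i q) * (K q p * φ i p)) :=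
            Finset.sum_congr rfl fun q _ => Finset.sum_comm
        _ = ∑ i ∈ Λ, ∑ q, ∑ p, (μ i : ℂ) * (conj (φ i q) * (K q p * φ i p)) := Finset.sum_comm
        _ = ∑ i ∈ Λ, (μ i : ℂ) * T i := by
            refine Finset.sum_congr rfl fun i _ => ?_
            rw [hT]; dsimp only
            rw [dotProduct, Finset.mul_sum]
            refine Finset.sum_congr rfl fun q _ => ?_
            rw [Pi.star_apply, RCLike.star_def, Matrix.mulVec, dotProduct, Finset.mul_sum, Finset.mul_sum]
    -- Cauchy–Schwarz over the pair index
    have hKfrob : (∑ q, ∑ p, ‖K q p‖ ^ 2) ≤ (n : ℝ) ^ 2 := by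
      have h1 : (∑ q, ∑ p, ‖K q p‖ ^ 2) = ∑ x : Fin n × Fin n, ∑ y : Fin n × Fin n, ‖X x y‖ ^ 2 := by
        rw [hKdef, sum_sum_ptr_reindex (F := fun q p => ‖ptr X q p‖ ^ 2)]
        rfl
      rw [h1]
      refine (frob_le_card_of_isContr X hXc).trans (le_of_eq ?_)
      simp [Fintype.card_prod, Fintype.card_fin, sq]
    have hRfrob : (∑ p, ∑ q, ‖RΛ p q‖ ^ 2) = ∑ i ∈ Λ, μ i ^ 2 := frob_partial_eigen hR.1 Λ
    have hμle : ∀ i ∈ Λ, μ i ≤ M / θ := by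
      intro i hi
      rw [hΛ, Finset.mem_filter] at hi
      rw [le_div_iff₀ hθ]
      calc μ i * θ ≤ μ i * ρ i ^ 2 := mul_le_mul_of_nonneg_left hi.2 (hμnn i)
        _ ≤ M := hμρ i
    have hsumsq : (∑ i ∈ Λ, μ i ^ 2) ≤ t * M / θ := by
      calc (∑ i ∈ Λ, μ i ^ 2) ≤ ∑ i ∈ Λ, μ i * (M / θ) :=
            Finset.sum_le_sum fun i hi => by rw [sq]; exact mul_le_mul_of_nonneg_left (hμle i hi) (hμnn i)
        _ ≤ ∑ i, μ i * (M / θ) :=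
            Finset.sum_le_sum_of_subset_of_nonneg (Finset.filter_subset _ _)
              (fun i _ _ => mul_nonneg (hμnn i) (div_nonneg hM0 hθ.le))
        _ = t * M / θ := by rw [← Finset.sum_mul, ← htsum]; ring
    -- |Σ_{q,p} K q p RΛ p q| ≤ ‖K‖_F ‖RΛ‖_F
    have hcs : ‖∑ q, ∑ p, K q p * RΛ p q‖ ^ 2 ≤ (∑ q, ∑ p, ‖K q p‖ ^ 2) * ∑ p, ∑ q, ‖RΛ p q‖ ^ 2 := by
      have h := norm_sum_conj_mul_sq_le (fun z : (Fin n × Fin n) × (Fin n × Fin n) => conj (K z.1 z.2))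
        (fun z => RΛ z.2 z.1)
      have hl : (∑ z : (Fin n × Fin n) × (Fin n × Fin n), conj (conj (K z.1 z.2)) * RΛ z.2 z.1) =
          ∑ q, ∑ p, K q p * RΛ p q := by
        rw [Fintype.sum_prod_type]
        exact Finset.sum_congr rfl fun q _ => Finset.sum_congr rfl fun p _ => by rw [Complex.conj_conj]
      have h2 : nsq (fun z : (Fin n × Fin n) × (Fin n × Fin n) => conj (K z.1 z.2)) = ∑ q, ∑ p, ‖K q p‖ ^ 2 := by
        unfold nsq; rw [Fintype.sum_prod_type]; try simp_rw [Complex.norm_conj]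
      have h3 : nsq (fun z : (Fin n × Fin n) × (Fin n × Fin n) => RΛ z.2 z.1) = ∑ p, ∑ q, ‖RΛ p q‖ ^ 2 := by
        unfold nsq; rw [Fintype.sum_prod_type, Finset.sum_comm]
      rw [hl, h2, h3] at h
      exact h
    calc (∑ i ∈ Λ, ((μ i : ℂ) * T i).re) = (∑ i ∈ Λ, (μ i : ℂ) * T i).re := by rw [Complex.re_sum]
      _ ≤ ‖∑ i ∈ Λ, (μ i : ℂ) * T i‖ := Complex.re_le_norm _
      _ = ‖∑ q, ∑ p, K q p * RΛ p q‖ := by rw [hsumT]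
      _ ≤ Real.sqrt ((∑ q, ∑ p, ‖K q p‖ ^ 2) * ∑ p, ∑ q, ‖RΛ p q‖ ^ 2) := by
          rw [← Real.sqrt_sq (norm_nonneg _)]
          exact Real.sqrt_le_sqrt hcs
      _ ≤ Real.sqrt ((n : ℝ) ^ 2 * (t * M / θ)) := by
          refine Real.sqrt_le_sqrt ?_
          rw [hRfrob]
          exact mul_le_mul hKfrob hsumsq (Finset.sum_nonneg fun i _ => sq_nonneg _) (sq_nonneg _)
      _ = n * Real.sqrt (t * M / θ) := by
          rw [Real.sqrt_mul (sq_nonneg _), Real.sqrt_sq (Nat.cast_nonneg n)]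
  linarith [hhead, htail]

end Bound


/-! ## Stage C: assembly -/

section Assembly

open scoped BigOperators ComplexConjugate ComplexOrder
open Matrix Literature.Computability.AlgebraicComplexity

variable {n d : ℕ}

/-- The (un-transposed) REDUCED MIDDLE-PAIR OPERATOR of a family `e`: `R_e = Tr_{κν} Σ_s |e_s⟩⟨e_s|`,
`R_e (μ,μ') (λ,λ') = Σ_s Σ_{κ,ν} e_s (κ,μ) (μ',ν) · conj e_s (κ,λ) (λ',ν)`. -/
def frameOp (e : Fin d → (Fin n × Fin n) → (Fin n × Fin n) → ℂ) : Matrix (Fin n × Fin n) (Fin n × Fin n) ℂ :=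
  Matrix.of fun x y => ∑ s, ∑ κ : Fin n, ∑ ν : Fin n, e s (κ, x.1) (x.2, ν) * conj (e s (κ, y.1) (y.2, ν))

/-- The flattening `B x (s,κ,ν) = e_s (κ,x.1) (x.2,ν)` with `R_e = B Bᴴ`. -/
def frameMat (e : Fin d → (Fin n × Fin n) → (Fin n × Fin n) → ℂ) :
    Matrix (Fin n × Fin n) (Fin d × Fin n × Fin n) ℂ :=
  Matrix.of fun x j => e j.1 (j.2.1, x.1) (x.2, j.2.2)

theorem frameOp_eq_mul (e : Fin d → (Fin n × Fin n) → (Fin n × Fin n) → ℂ) :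
    frameOp e = frameMat e * (frameMat e)ᴴ := by
  ext x y
  simp only [frameOp, frameMat, Matrix.mul_apply, Matrix.conjTranspose_apply, Matrix.of_apply, RCLike.star_def]
  rw [Fintype.sum_prod_type]
  refine Finset.sum_congr rfl fun s _ => ?_
  rw [Fintype.sum_prod_type]

/-- `R_e` is positive semidefinite. -/
theorem frameOp_posSemidef (e : Fin d → (Fin n × Fin n) → (Fin n × Fin n) → ℂ) : (frameOp e).PosSemidef := by
  rw [frameOp_eq_mul]; exact Matrix.posSemidef_self_mul_conjTranspose _

/-- Its partial transpose is the line's `redPT e` (the matrix of the stub). -/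
theorem ptr_frameOp (e : Fin d → (Fin n × Fin n) → (Fin n × Fin n) → ℂ) :
    ptr (frameOp e) = Matrix.of fun x y : Fin n × Fin n =>
      ∑ s, ∑ κ : Fin n, ∑ ν : Fin n, e s (κ, x.1) (y.2, ν) * conj (e s (κ, y.1) (x.2, ν)) := by
  ext x y; rfl

/-- Its trace is the total mass of the family (`= d` for an orthonormal frame). -/
theorem frameOp_trace_re (e : Fin d → (Fin n × Fin n) → (Fin n × Fin n) → ℂ)
    (he : ∀ s t : Fin d, (∑ b, ∑ c, conj (e s b c) * e t b c) = if s = t then 1 else 0) :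
    (frameOp e).trace.re = d := by
  have h1 : (frameOp e).trace = ∑ s, ∑ b : Fin n × Fin n, ∑ c : Fin n × Fin n, conj (e s b c) * e s b c := by
    unfold Matrix.trace
    calc (∑ x, (frameOp e).diag x) = ∑ x : Fin n × Fin n, ∑ s, ∑ κ : Fin n, ∑ ν : Fin n,
          conj (e s (κ, x.1) (x.2, ν)) * e s (κ, x.1) (x.2, ν) := by
          refine Finset.sum_congr rfl fun x _ => ?_
          simp only [Matrix.diag_apply, frameOp, Matrix.of_apply]
          exact Finset.sum_congr rfl fun s _ => Finset.sum_congr rfl fun κ _ =>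
            Finset.sum_congr rfl fun ν _ => mul_comm _ _
      _ = ∑ s, ∑ x : Fin n × Fin n, ∑ κ : Fin n, ∑ ν : Fin n,
          conj (e s (κ, x.1) (x.2, ν)) * e s (κ, x.1) (x.2, ν) := Finset.sum_comm
      _ = ∑ s, ∑ b : Fin n × Fin n, ∑ c : Fin n × Fin n, conj (e s b c) * e s b c := by
          refine Finset.sum_congr rfl fun s _ => ?_
          -- Σ_{(μ,μ')} Σ_κ Σ_ν f (κ,μ) (μ',ν) = Σ_{(κ,μ)} Σ_{(μ',ν)} f
          rw [Fintype.sum_prod_type, Fintype.sum_prod_type]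
          calc (∑ μ : Fin n, ∑ μ' : Fin n, ∑ κ : Fin n, ∑ ν : Fin n, conj (e s (κ, μ) (μ', ν)) * e s (κ, μ) (μ', ν))
              = ∑ μ : Fin n, ∑ κ : Fin n, ∑ μ' : Fin n, ∑ ν : Fin n, conj (e s (κ, μ) (μ', ν)) * e s (κ, μ) (μ', ν) :=
                Finset.sum_congr rfl fun μ _ => Finset.sum_comm
            _ = ∑ κ : Fin n, ∑ μ : Fin n, ∑ μ' : Fin n, ∑ ν : Fin n, conj (e s (κ, μ) (μ', ν)) * e s (κ, μ) (μ', ν) :=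
                Finset.sum_comm
            _ = _ := by
                refine Finset.sum_congr rfl fun κ _ => Finset.sum_congr rfl fun μ _ => ?_
                exact (Fintype.sum_prod_type (f := fun c : Fin n × Fin n => conj (e s (κ, μ) c) * e s (κ, μ) c)).symm
  rw [h1]
  simp_rw [he]
  simp

/-- The quadratic form of `R_e` at a vector `Ψ` is the `conj Ψ`-twisted capture of `e`. -/
theorem frameOp_quadform (e : Fin d → (Fin n × Fin n) → (Fin n × Fin n) → ℂ) (Ψ : Fin n × Fin n → ℂ) :
    star Ψ ⬝ᵥ (frameOp e *ᵥ Ψ) = ((capTwist e (Matrix.of fun m m' => conj (Ψ (m, m'))) : ℝ) : ℂ) := by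
  have hsq : ∀ z : ℂ, ((‖z‖ ^ 2 : ℝ) : ℂ) = z * conj z := fun z => by
    rw [Complex.mul_conj, Complex.normSq_eq_norm_sq, Complex.ofReal_pow]
  -- the twisted coefficient as a scalar product against Ψ
  have hco : ∀ s (κ ν : Fin n), twCoeff e (Matrix.of fun m m' => conj (Ψ (m, m'))) s (κ, ν) =
      ∑ x : Fin n × Fin n, conj (Ψ x) * e s (κ, x.1) (x.2, ν) := by
    intro s κ ν
    rw [twCoeff, Fintype.sum_prod_type]
    exact Finset.sum_congr rfl fun m _ => Finset.sum_congr rfl fun m' _ => by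
      rw [Matrix.of_apply]; ring
  symm
  calc ((capTwist e (Matrix.of fun m m' => conj (Ψ (m, m'))) : ℝ) : ℂ)
      = ∑ s, ∑ κ : Fin n, ∑ ν : Fin n, (∑ x : Fin n × Fin n, conj (Ψ x) * e s (κ, x.1) (x.2, ν)) *
          conj (∑ y : Fin n × Fin n, conj (Ψ y) * e s (κ, y.1) (y.2, ν)) := by
        unfold capTwist
        rw [Complex.ofReal_sum]
        refine Finset.sum_congr rfl fun s _ => ?_
        rw [Complex.ofReal_sum, Fintype.sum_prod_type]
        exact Finset.sum_congr rfl fun κ _ => Finset.sum_congr rfl fun ν _ => by rw [hsq, hco]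
    _ = ∑ s, ∑ κ : Fin n, ∑ ν : Fin n, ∑ x : Fin n × Fin n, ∑ y : Fin n × Fin n,
          conj (Ψ x) * (e s (κ, x.1) (x.2, ν) * conj (e s (κ, y.1) (y.2, ν)) * Ψ y) := by
        refine Finset.sum_congr rfl fun s _ => Finset.sum_congr rfl fun κ _ => Finset.sum_congr rfl fun ν _ => ?_
        rw [map_sum, Finset.sum_mul_sum]
        refine Finset.sum_congr rfl fun x _ => Finset.sum_congr rfl fun y _ => ?_
        rw [map_mul, Complex.conj_conj]; ring
    _ = ∑ x : Fin n × Fin n, ∑ y : Fin n × Fin n, ∑ s, ∑ κ : Fin n, ∑ ν : Fin n,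
          conj (Ψ x) * (e s (κ, x.1) (x.2, ν) * conj (e s (κ, y.1) (y.2, ν)) * Ψ y) := by
        -- move x, y to the front
        calc (∑ s, ∑ κ : Fin n, ∑ ν : Fin n, ∑ x : Fin n × Fin n, ∑ y : Fin n × Fin n,
              conj (Ψ x) * (e s (κ, x.1) (x.2, ν) * conj (e s (κ, y.1) (y.2, ν)) * Ψ y))
            = ∑ s, ∑ κ : Fin n, ∑ x : Fin n × Fin n, ∑ ν : Fin n, ∑ y : Fin n × Fin n,
              conj (Ψ x) * (e s (κ, x.1) (x.2, ν) * conj (e s (κ, y.1) (y.2, ν)) * Ψ y) :=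
              Finset.sum_congr rfl fun s _ => Finset.sum_congr rfl fun κ _ => Finset.sum_comm
          _ = ∑ s, ∑ x : Fin n × Fin n, ∑ κ : Fin n, ∑ ν : Fin n, ∑ y : Fin n × Fin n,
              conj (Ψ x) * (e s (κ, x.1) (x.2, ν) * conj (e s (κ, y.1) (y.2, ν)) * Ψ y) :=
              Finset.sum_congr rfl fun s _ => Finset.sum_comm
          _ = ∑ x : Fin n × Fin n, ∑ s, ∑ κ : Fin n, ∑ ν : Fin n, ∑ y : Fin n × Fin n,
              conj (Ψ x) * (e s (κ, x.1) (x.2, ν) * conj (e s (κ, y.1) (y.2, ν)) * Ψ y) := Finset.sum_comm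
          _ = ∑ x : Fin n × Fin n, ∑ s, ∑ κ : Fin n, ∑ y : Fin n × Fin n, ∑ ν : Fin n,
              conj (Ψ x) * (e s (κ, x.1) (x.2, ν) * conj (e s (κ, y.1) (y.2, ν)) * Ψ y) :=
              Finset.sum_congr rfl fun x _ => Finset.sum_congr rfl fun s _ =>
                Finset.sum_congr rfl fun κ _ => Finset.sum_comm
          _ = ∑ x : Fin n × Fin n, ∑ s, ∑ y : Fin n × Fin n, ∑ κ : Fin n, ∑ ν : Fin n,
              conj (Ψ x) * (e s (κ, x.1) (x.2, ν) * conj (e s (κ, y.1) (y.2, ν)) * Ψ y) :=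
              Finset.sum_congr rfl fun x _ => Finset.sum_congr rfl fun s _ => Finset.sum_comm
          _ = ∑ x : Fin n × Fin n, ∑ y : Fin n × Fin n, ∑ s, ∑ κ : Fin n, ∑ ν : Fin n,
              conj (Ψ x) * (e s (κ, x.1) (x.2, ν) * conj (e s (κ, y.1) (y.2, ν)) * Ψ y) :=
              Finset.sum_congr rfl fun x _ => Finset.sum_comm
    _ = star Ψ ⬝ᵥ (frameOp e *ᵥ Ψ) := by
        simp only [dotProduct, Matrix.mulVec, frameOp, Matrix.of_apply, Pi.star_apply, RCLike.star_def,
          Finset.mul_sum, Finset.sum_mul]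

/-- The final real-arithmetic step: with `t = d ≤ n²`, `M = C₁ n^{3−2δ}`, `θ = C₁ n^{1−δ}`:
`n √(t M / θ) + t √(n θ) ≤ (1 + √C₁) n^{3 − 2(δ/4)}`. -/
theorem final_arith {n : ℕ} (hn : 0 < n) {C₁ δ d : ℝ} (hC : 1 ≤ C₁) (hd0 : 0 ≤ d) (hd : d ≤ (n : ℝ) ^ 2) :
    (n : ℝ) * Real.sqrt (d * (C₁ * (n : ℝ) ^ (3 - 2 * δ)) / (C₁ * (n : ℝ) ^ (1 - δ))) +
      d * Real.sqrt ((n : ℝ) * (C₁ * (n : ℝ) ^ (1 - δ))) ≤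
      (1 + Real.sqrt C₁) * (n : ℝ) ^ (3 - 2 * (δ / 4)) := by
  have hx : (0 : ℝ) < n := Nat.cast_pos.mpr hn
  have hx0 : (0 : ℝ) ≤ n := hx.le
  have hC0 : 0 < C₁ := lt_of_lt_of_le one_pos hC
  set x : ℝ := (n : ℝ) with hxdef
  -- first term
  have h1 : d * (C₁ * x ^ (3 - 2 * δ)) / (C₁ * x ^ (1 - δ)) = d * x ^ (2 - δ) := by
    rw [mul_div_assoc, mul_div_mul_left _ _ hC0.ne', ← Real.rpow_sub hx,
      show (3 - 2 * δ) - (1 - δ) = (2 - δ : ℝ) by ring]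
  have hx2 : x ^ 2 = x ^ (2 : ℝ) := by rw [← Real.rpow_natCast]; norm_num
  have h1' : x * Real.sqrt (d * (C₁ * x ^ (3 - 2 * δ)) / (C₁ * x ^ (1 - δ))) ≤ x ^ (3 - δ / 2) := by
    rw [h1]
    calc x * Real.sqrt (d * x ^ (2 - δ)) ≤ x * Real.sqrt (x ^ 2 * x ^ (2 - δ)) := by
          refine mul_le_mul_of_nonneg_left (Real.sqrt_le_sqrt ?_) hx0
          exact mul_le_mul_of_nonneg_right hd (Real.rpow_nonneg hx0 _)
      _ = x ^ (3 - δ / 2) := by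
          rw [hx2, ← Real.rpow_add hx, Real.sqrt_eq_rpow, ← Real.rpow_mul hx0,
            show x * x ^ ((2 + (2 - δ)) * (1 / 2)) = x ^ (1 : ℝ) * x ^ ((2 + (2 - δ)) * (1 / 2)) by
              rw [Real.rpow_one], ← Real.rpow_add hx]
          congr 1; ring
  -- second term
  have h2' : d * Real.sqrt (x * (C₁ * x ^ (1 - δ))) ≤ Real.sqrt C₁ * x ^ (3 - δ / 2) := by
    have hs : Real.sqrt (x * (C₁ * x ^ (1 - δ))) = Real.sqrt C₁ * x ^ (1 - δ / 2) := by
      rw [show x * (C₁ * x ^ (1 - δ)) = C₁ * (x ^ (1 : ℝ) * x ^ (1 - δ)) by rw [Real.rpow_one]; ring,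
        ← Real.rpow_add hx, Real.sqrt_mul hC0.le, Real.sqrt_eq_rpow (x ^ _), ← Real.rpow_mul hx0]
      congr 2; ring
    rw [hs]
    calc d * (Real.sqrt C₁ * x ^ (1 - δ / 2)) ≤ x ^ 2 * (Real.sqrt C₁ * x ^ (1 - δ / 2)) :=
          mul_le_mul_of_nonneg_right hd (mul_nonneg (Real.sqrt_nonneg _) (Real.rpow_nonneg hx0 _))
      _ = Real.sqrt C₁ * x ^ (3 - δ / 2) := by
          rw [hx2, show x ^ (2 : ℝ) * (Real.sqrt C₁ * x ^ (1 - δ / 2)) = Real.sqrt C₁ * (x ^ (2 : ℝ) * x ^ (1 - δ / 2)) by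
            ring, ← Real.rpow_add hx]
          congr 2; ring
  have hexp : (3 - 2 * (δ / 4) : ℝ) = 3 - δ / 2 := by ring
  rw [hexp]
  calc x * Real.sqrt (d * (C₁ * x ^ (3 - 2 * δ)) / (C₁ * x ^ (1 - δ))) + d * Real.sqrt (x * (C₁ * x ^ (1 - δ)))
      ≤ x ^ (3 - δ / 2) + Real.sqrt C₁ * x ^ (3 - δ / 2) := add_le_add h1' h2'
    _ = (1 + Real.sqrt C₁) * x ^ (3 - δ / 2) := by ring

/-- **The converse of the line: `DiagonalPowerDecay ⇒ stub_middlePairNegativityDecay`.** If the crux body holds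
at `(C, δ)`, `δ > 0`, then the partially transposed middle-pair reduction of every `n²`-product frame splits as
`Y − Z`, `Y, Z ⪰ 0`, with `tr Y + tr Z ≤ (1 + √(max C 1)) · n^{3 − 2(δ/4)}`.  With the skeleton's
`DiagonalPowerDecay_of` (stub ⇒ crux) this makes the line's open stub EQUIVALENT to the crux. -/
theorem middlePairNegativityDecay_of_body {C δ : ℝ} (hδ : 0 < δ)
    (hB : ∀ n : ℕ, ∀ S : (Fin n × Fin n) → (Fin n × Fin n) → (Fin n × Fin n) → ℂ, tensorRank S ≤ n ^ 2 →
      ‖∑ a, ∑ b, ∑ c, S a b c * matMulTensor ℂ n n n a b c‖ ^ 2 ≤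
        C * (n : ℝ) ^ (3 - 2 * δ) * ∑ a, ∑ b, ∑ c, ‖S a b c‖ ^ 2) :
    ∃ C' δ' : ℝ, 0 < δ' ∧ ∀ (n d : ℕ) (u v : Fin (n ^ 2) → (Fin n × Fin n) → ℂ)
      (e : Fin d → (Fin n × Fin n) → (Fin n × Fin n) → ℂ), d ≤ n ^ 2 →
      (∀ s t : Fin d, (∑ b, ∑ c, conj (e s b c) * e t b c) = if s = t then 1 else 0) →
      (∀ s, e s ∈ Submodule.span ℂ (Set.range fun l : Fin (n ^ 2) => fun b c => u l b * v l c)) →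
      (∀ l : Fin (n ^ 2), (fun b c => u l b * v l c) ∈ Submodule.span ℂ (Set.range e)) →
      ∃ Y Z : Matrix (Fin n × Fin n) (Fin n × Fin n) ℂ, Y.PosSemidef ∧ Z.PosSemidef ∧
        (Matrix.of fun x y : Fin n × Fin n =>
          ∑ s, ∑ κ : Fin n, ∑ ν : Fin n, e s (κ, x.1) (y.2, ν) * conj (e s (κ, y.1) (x.2, ν))) = Y - Z ∧
        (Y.trace + Z.trace).re ≤ C' * (n : ℝ) ^ (3 - 2 * δ') := by
  classical
  set C₁ := max C 1 with hC₁
  have hC1 : 1 ≤ C₁ := le_max_right _ _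
  have hC0 : 0 ≤ C₁ := le_trans zero_le_one hC1
  -- the body with the larger constant
  have hB₁ : ∀ n : ℕ, ∀ S : (Fin n × Fin n) → (Fin n × Fin n) → (Fin n × Fin n) → ℂ, tensorRank S ≤ n ^ 2 →
      ‖∑ a, ∑ b, ∑ c, S a b c * matMulTensor ℂ n n n a b c‖ ^ 2 ≤
        C₁ * (n : ℝ) ^ (3 - 2 * δ) * ∑ a, ∑ b, ∑ c, ‖S a b c‖ ^ 2 := by
    intro n S hS
    refine (hB n S hS).trans ?_
    have hnn : 0 ≤ (n : ℝ) ^ (3 - 2 * δ) * ∑ a, ∑ b, ∑ c, ‖S a b c‖ ^ 2 :=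
      mul_nonneg (Real.rpow_nonneg (Nat.cast_nonneg n) _) (by positivity)
    rw [mul_assoc, mul_assoc]
    exact mul_le_mul_of_nonneg_right (le_max_left C 1) hnn
  refine ⟨1 + Real.sqrt C₁, δ / 4, by linarith, ?_⟩
  intro n d u v e hd he hps _hprod
  rcases Nat.eq_zero_or_pos n with hn0 | hn
  · -- n = 0: everything is empty
    subst hn0
    refine ⟨0, 0, Matrix.PosSemidef.zero, Matrix.PosSemidef.zero, ?_, ?_⟩
    · ext x y; exact Fin.elim0 x.1
    · simp only [Matrix.trace_zero, add_zero, Complex.zero_re]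
      exact mul_nonneg (by positivity) (Real.rpow_nonneg (Nat.cast_nonneg 0) _)
  -- n ≥ 1
  set R := frameOp e with hR
  have hRpsd : R.PosSemidef := frameOp_posSemidef e
  set M : ℝ := C₁ * (n : ℝ) ^ (3 - 2 * δ) with hM
  set θ : ℝ := C₁ * (n : ℝ) ^ (1 - δ) with hθ
  have hxpos : (0 : ℝ) < n := Nat.cast_pos.mpr hn
  have hθpos : 0 < θ := mul_pos (lt_of_lt_of_le one_pos hC1) (Real.rpow_pos_of_pos hxpos _)
  have hMcap : ∀ Ψ : Fin n × Fin n → ℂ, IsSubunitary Ψ → (star Ψ ⬝ᵥ (R *ᵥ Ψ)).re ≤ M := by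
    intro Ψ hΨ
    rw [hR, frameOp_quadform, Complex.ofReal_re]
    refine capTwist_le_of_body hC0 hB₁ (le_refl (n ^ 2)) u v e he hps _ ?_
    intro x
    have h := hΨ x
    unfold nsq at h
    refine le_of_eq_of_le ?_ h
    refine Finset.sum_congr rfl fun m _ => ?_
    simp only [Matrix.mulVec, dotProduct, Matrix.of_apply]
  obtain ⟨Y, Z, hY, hZ, hsplit, htr⟩ := ptr_traceNorm_bound R hRpsd hθpos hMcap
  refine ⟨Y, Z, hY, hZ, ?_, ?_⟩
  · rw [← hsplit, hR, ptr_frameOp]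
  · refine htr.trans ?_
    have ht : R.trace.re = d := frameOp_trace_re e he
    rw [ht]
    have hdle : (d : ℝ) ≤ (n : ℝ) ^ 2 := by exact_mod_cast hd
    exact final_arith hn hC1 (Nat.cast_nonneg d) hdle

end Assembly

/-! ## Stage D: the equivalence with the crux -/

section Equivalence

open scoped BigOperators ComplexConjugate ComplexOrder Matrix
open Literature.Computability.AlgebraicComplexity
open Summit.MatrixMultiplication.MatrixMultiplication.Theses.FidelityWitnesses (DiagonalPowerDecay)

/-- **MIDDLE-PAIR NEGATIVITY DECAY** — the open stub of line `frame-negativity-singlet-fraction`, verbatim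
(`stub_middlePairNegativityDecay` of `Cruxes/DiagonalPowerDecay/Lines/frame_negativity_singlet_fraction.lean`): for every
`n²` products `u_l ⊗ v_l` and every orthonormal basis `e` of their span, the partially transposed middle-pair reduction
`(Tr_{κν} P_E)^{Γ_{μ'}}` splits as `Y − Z`, `Y, Z ⪰ 0`, `tr Y + tr Z ≤ C n^{3−2δ}`. -/
def MiddlePairNegativityDecay : Prop :=
  ∃ C δ : ℝ, 0 < δ ∧ ∀ (n d : ℕ) (u v : Fin (n ^ 2) → (Fin n × Fin n) → ℂ)
    (e : Fin d → (Fin n × Fin n) → (Fin n × Fin n) → ℂ), d ≤ n ^ 2 →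
    (∀ s t : Fin d, (∑ b, ∑ c, conj (e s b c) * e t b c) = if s = t then 1 else 0) →
    (∀ s, e s ∈ Submodule.span ℂ (Set.range fun l : Fin (n ^ 2) => fun b c => u l b * v l c)) →
    (∀ l : Fin (n ^ 2), (fun b c => u l b * v l c) ∈ Submodule.span ℂ (Set.range e)) →
    ∃ Y Z : Matrix (Fin n × Fin n) (Fin n × Fin n) ℂ, Y.PosSemidef ∧ Z.PosSemidef ∧
      (Matrix.of fun x y : Fin n × Fin n =>
        ∑ s, ∑ κ : Fin n, ∑ ν : Fin n, e s (κ, x.1) (y.2, ν) * conj (e s (κ, y.1) (x.2, ν))) = Y - Z ∧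
      (Y.trace + Z.trace).re ≤ C * (n : ℝ) ^ (3 - 2 * δ)

/-- **Crux ⇒ stub.** `DiagonalPowerDecay → MiddlePairNegativityDecay` (Stages A–C). -/
theorem middlePairNegativityDecay_of_diagonalPowerDecay (h : DiagonalPowerDecay) : MiddlePairNegativityDecay := by
  obtain ⟨C, δ, hδ, hB⟩ := h
  exact middlePairNegativityDecay_of_body hδ hB

/-! ### Stub ⇒ crux (the line's own lever, as in the skeleton: slice elimination + singlet ≤ negativity) -/

/-- The FLIP `(μ,μ') ↦ (μ',μ)` as a permutation matrix. -/
def flipM (n : ℕ) : Matrix (Fin n × Fin n) (Fin n × Fin n) ℂ :=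
  Matrix.of fun x y => if y = (x.2, x.1) then 1 else 0

theorem flipM_apply {n : ℕ} (x y : Fin n × Fin n) : flipM n x y = if y = (x.2, x.1) then 1 else 0 := rfl

/-- Trace against the flip reads off the flipped diagonal. -/
theorem trace_mul_flipM {n : ℕ} (M : Matrix (Fin n × Fin n) (Fin n × Fin n) ℂ) :
    (M * flipM n).trace = ∑ x, M x (x.2, x.1) := by
  unfold Matrix.trace
  refine Finset.sum_congr rfl fun x _ => ?_
  rw [Matrix.diag_apply, Matrix.mul_apply, Finset.sum_eq_single (x.2, x.1)]
  · simp [flipM_apply]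
  · intro y _ hy
    rw [flipM_apply, if_neg, mul_zero]
    intro h
    apply hy
    rw [h]
  · intro h; exact absurd (Finset.mem_univ _) h

/-- The flip is an involution. -/
theorem flipM_mul_flipM {n : ℕ} : flipM n * flipM n = 1 := by
  ext x z
  rw [Matrix.mul_apply, Finset.sum_eq_single (x.2, x.1)]
  · rw [flipM_apply, flipM_apply, if_pos rfl, one_mul, Matrix.one_apply]
    by_cases h : x = z
    · subst h; simp
    · rw [if_neg, if_neg h]
      intro hz; apply h; rw [hz]
  · intro y _ hy
    rw [flipM_apply, if_neg (Ne.symm (fun h => hy h.symm)), zero_mul]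
  · intro h; exact absurd (Finset.mem_univ _) h

/-- The flip is Hermitian. -/
theorem flipM_conjTranspose {n : ℕ} : (flipM n)ᴴ = flipM n := by
  ext x y
  rw [Matrix.conjTranspose_apply, flipM_apply, flipM_apply]
  by_cases h : y = (x.2, x.1)
  · have h' : x = (y.2, y.1) := by rw [h]
    rw [if_pos h, if_pos h', star_one]
  · have h' : ¬ x = (y.2, y.1) := fun h' => h (by rw [h'])
    rw [if_neg h, if_neg h', star_zero]

/-- **Singlet fraction ≤ negativity** as a matrix fact: for PSD `Y, Z`, `Re Σ_x (Y − Z)(x, flip x) ≤ Re (tr Y + tr Z)`. -/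
theorem flipTraceBound {n : ℕ} (Y Z : Matrix (Fin n × Fin n) (Fin n × Fin n) ℂ)
    (hY : Y.PosSemidef) (hZ : Z.PosSemidef) :
    (∑ x : Fin n × Fin n, (Y - Z) x (x.2, x.1)).re ≤ (Y.trace + Z.trace).re := by
  set F := flipM n with hFdef
  have hFF : F * F = 1 := flipM_mul_flipM
  have hFH : Fᴴ = F := flipM_conjTranspose
  have hsq1 : (1 - F)ᴴ * (1 - F) = 1 - F - F + 1 := by
    rw [Matrix.conjTranspose_sub, Matrix.conjTranspose_one, hFH, sub_mul, one_mul, mul_sub, mul_one, hFF]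
    abel
  have hsq2 : (1 + F)ᴴ * (1 + F) = 1 + F + F + 1 := by
    rw [Matrix.conjTranspose_add, Matrix.conjTranspose_one, hFH, add_mul, one_mul, mul_add, mul_one, hFF]
    abel
  have e1 := Literature.LinearAlgebra.Matrix.re_trace_mul_nonneg_of_posSemidef hY
    (Matrix.posSemidef_conjTranspose_mul_self (1 - F))
  have e2 := Literature.LinearAlgebra.Matrix.re_trace_mul_nonneg_of_posSemidef hZ
    (Matrix.posSemidef_conjTranspose_mul_self (1 + F))
  rw [hsq1, Matrix.mul_add, Matrix.mul_sub, Matrix.mul_sub, Matrix.mul_one, Matrix.trace_add,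
    Matrix.trace_sub, Matrix.trace_sub] at e1
  rw [hsq2, Matrix.mul_add, Matrix.mul_add, Matrix.mul_add, Matrix.mul_one, Matrix.trace_add,
    Matrix.trace_add, Matrix.trace_add] at e2
  simp only [Complex.add_re, Complex.sub_re] at e1 e2
  rw [← trace_mul_flipM, Matrix.sub_mul, Matrix.trace_sub, Complex.sub_re, Complex.add_re]
  linarith

/-- The singlet identity: the capture `Σ_s Σ_a |Σ_m e_s (a.1,m) (m,a.2)|²` is the flipped diagonal sum of the
stub's matrix. -/
theorem sum_redPT_flip {n d : ℕ} (e : Fin d → (Fin n × Fin n) → (Fin n × Fin n) → ℂ) :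
    (∑ x : Fin n × Fin n, (Matrix.of fun x y : Fin n × Fin n =>
        ∑ s, ∑ κ : Fin n, ∑ ν : Fin n, e s (κ, x.1) (y.2, ν) * conj (e s (κ, y.1) (x.2, ν))) x (x.2, x.1)) =
      (((∑ s, ∑ a : Fin n × Fin n, ‖∑ m : Fin n, e s (a.1, m) (m, a.2)‖ ^ 2 : ℝ)) : ℂ) := by
  have hsq : ∀ z : ℂ, ((‖z‖ : ℝ) : ℂ) ^ 2 = z * conj z := fun z => by
    rw [Complex.mul_conj, Complex.normSq_eq_norm_sq]; norm_cast
  calc (∑ x : Fin n × Fin n, (Matrix.of fun x y : Fin n × Fin n =>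
        ∑ s, ∑ κ : Fin n, ∑ ν : Fin n, e s (κ, x.1) (y.2, ν) * conj (e s (κ, y.1) (x.2, ν))) x (x.2, x.1))
      = ∑ x : Fin n × Fin n, ∑ s, ∑ a : Fin n × Fin n,
          e s (a.1, x.1) (x.1, a.2) * conj (e s (a.1, x.2) (x.2, a.2)) := by
        refine Finset.sum_congr rfl fun x _ => ?_
        simp only [Matrix.of_apply]
        refine Finset.sum_congr rfl fun s _ => ?_
        exact (Fintype.sum_prod_type' _).symm
    _ = ∑ s, ∑ a : Fin n × Fin n, ∑ x : Fin n × Fin n,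
          e s (a.1, x.1) (x.1, a.2) * conj (e s (a.1, x.2) (x.2, a.2)) := by
        rw [Finset.sum_comm]
        refine Finset.sum_congr rfl fun s _ => ?_
        rw [Finset.sum_comm]
    _ = ∑ s, ∑ a : Fin n × Fin n, (∑ m : Fin n, e s (a.1, m) (m, a.2)) * conj (∑ m : Fin n, e s (a.1, m) (m, a.2)) := by
        refine Finset.sum_congr rfl fun s _ => Finset.sum_congr rfl fun a _ => ?_
        rw [map_sum, Finset.sum_mul_sum]
        exact Fintype.sum_prod_type' fun m m' : Fin n => e s (a.1, m) (m, a.2) * conj (e s (a.1, m') (m', a.2))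
    _ = _ := by
        simp only [Complex.ofReal_sum, Complex.ofReal_pow, hsq]

/-- Cauchy–Schwarz for a finite complex double sum (from the tree's single-sum version). -/
theorem norm_sum_sum_mul_sq_le {α β : Type*} [Fintype α] [Fintype β] (f g : α → β → ℂ) :
    ‖∑ a, ∑ s, f a s * g a s‖ ^ 2 ≤ (∑ a, ∑ s, ‖f a s‖ ^ 2) * ∑ a, ∑ s, ‖g a s‖ ^ 2 := by
  have h := SevenEighthsLaw.norm_sum_mul_sq_le Finset.univ (fun p : α × β => f p.1 p.2) (fun p => g p.1 p.2)
  simpa only [Fintype.sum_prod_type] using h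

/-- **Slice elimination (general `n`).** For an orthonormal frame `e` and a tensor `S` whose output slices lie in
`span e`: `|⟨S,⟨n,n,n⟩⟩|² ≤ ‖S‖² · Σ_s Σ_a |Σ_m e_s (a.1,m) (m,a.2)|²`. -/
theorem sliceElimination {n k : ℕ} (e : Fin k → (Fin n × Fin n) → (Fin n × Fin n) → ℂ)
    (he : ∀ s t : Fin k, (∑ b, ∑ c, conj (e s b c) * e t b c) = if s = t then 1 else 0)
    (S : (Fin n × Fin n) → (Fin n × Fin n) → (Fin n × Fin n) → ℂ)
    (hS : ∀ a : Fin n × Fin n, S a ∈ Submodule.span ℂ (Set.range e)) :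
    ‖∑ a, ∑ b, ∑ c, S a b c * matMulTensor ℂ n n n a b c‖ ^ 2
      ≤ (∑ a, ∑ b, ∑ c, ‖S a b c‖ ^ 2) *
        ∑ s, ∑ a : Fin n × Fin n, ‖∑ m : Fin n, e s (a.1, m) (m, a.2)‖ ^ 2 := by
  classical
  have hd : ∀ a : Fin n × Fin n, ∃ d : Fin k → ℂ, ∑ s, d s • e s = S a := fun a =>
    (Submodule.mem_span_range_iff_exists_fun ℂ).mp (hS a)
  choose d hd using hd
  have hexp : ∀ a b c, S a b c = ∑ s, d a s * e s b c := by
    intro a b c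
    have h := congrFun (congrFun (hd a) b) c
    simpa [Finset.sum_apply, Pi.smul_apply, smul_eq_mul] using h.symm
  have hL : ∑ a, ∑ b, ∑ c, S a b c * matMulTensor ℂ n n n a b c
      = ∑ a, ∑ s, d a s * ∑ m : Fin n, e s (a.1, m) (m, a.2) := by
    refine Finset.sum_congr rfl fun a _ => ?_
    rw [sepMajorant_slice_sum_matMulTensor (S a) a]
    calc ∑ m : Fin n, S a (a.1, m) (m, a.2) = ∑ m : Fin n, ∑ s, d a s * e s (a.1, m) (m, a.2) :=
          Finset.sum_congr rfl fun m _ => hexp a _ _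
      _ = ∑ s, ∑ m : Fin n, d a s * e s (a.1, m) (m, a.2) := Finset.sum_comm
      _ = ∑ s, d a s * ∑ m : Fin n, e s (a.1, m) (m, a.2) :=
          Finset.sum_congr rfl fun s _ => by rw [Finset.mul_sum]
  have hR : ∑ a, ∑ b, ∑ c, ‖S a b c‖ ^ 2 = ∑ a, ∑ s, ‖d a s‖ ^ 2 :=
    Finset.sum_congr rfl fun a _ => parseval_slice' e he (d a) (S a) (hexp a)
  rw [hL, hR, Finset.sum_comm (f := fun s (a : Fin n × Fin n) => ‖∑ m : Fin n, e s (a.1, m) (m, a.2)‖ ^ 2)]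
  exact norm_sum_sum_mul_sq_le d fun a s => ∑ m : Fin n, e s (a.1, m) (m, a.2)

/-- The output slices of a sum of triads lie in the span of any frame containing the products. -/
theorem slice_mem_span {n r d : ℕ} (e : Fin d → (Fin n × Fin n) → (Fin n × Fin n) → ℂ)
    (w u v : Fin r → (Fin n × Fin n) → ℂ)
    (hprod : ∀ l : Fin r, (fun b c => u l b * v l c) ∈ Submodule.span ℂ (Set.range e)) (a : Fin n × Fin n) :
    (∑ i, triad (w i) (u i) (v i)) a ∈ Submodule.span ℂ (Set.range e) := by
  have hslice : (∑ i, triad (w i) (u i) (v i)) a = ∑ i, w i a • (fun b c => u i b * v i c) := by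
    funext b c
    simp [Finset.sum_apply, triad_apply, Pi.smul_apply, smul_eq_mul, mul_assoc]
  rw [hslice]
  exact Submodule.sum_mem _ fun i _ => Submodule.smul_mem _ _ (hprod i)

/-- **Stub ⇒ crux** (the composition of the skeleton, with the stub as a hypothesis and the landed
`stub_productFrame`). -/
theorem diagonalPowerDecay_of_middlePairNegativityDecay (h : MiddlePairNegativityDecay) : DiagonalPowerDecay := by
  obtain ⟨C, δ, hδ, hneg⟩ := h
  refine ⟨C, δ, hδ, fun n S hS => ?_⟩
  obtain ⟨w, u, v, hdec⟩ := exists_eq_sum_triad_of_tensorRank_le hS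
  obtain ⟨d, e, hd, he, hps, hprod⟩ := stub_productFrame u v
  obtain ⟨Y, Z, hY, hZ, hsplit, htr⟩ := hneg n d u v e hd he hps hprod
  -- singlet fraction ≤ negativity
  have hcap : (∑ s, ∑ a : Fin n × Fin n, ‖∑ m : Fin n, e s (a.1, m) (m, a.2)‖ ^ 2) ≤ (Y.trace + Z.trace).re := by
    have hre : (∑ s, ∑ a : Fin n × Fin n, ‖∑ m : Fin n, e s (a.1, m) (m, a.2)‖ ^ 2) =
        (∑ x : Fin n × Fin n, (Y - Z) x (x.2, x.1)).re := by
      rw [← hsplit, sum_redPT_flip, Complex.ofReal_re]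
    rw [hre]
    exact flipTraceBound Y Z hY hZ
  have hslices : ∀ a : Fin n × Fin n, S a ∈ Submodule.span ℂ (Set.range e) := by
    intro a; rw [hdec]; exact slice_mem_span e w u v hprod a
  have h1 := sliceElimination e he S hslices
  have hnn : (0 : ℝ) ≤ ∑ a, ∑ b, ∑ c, ‖S a b c‖ ^ 2 := by positivity
  calc ‖∑ a, ∑ b, ∑ c, S a b c * matMulTensor ℂ n n n a b c‖ ^ 2
      ≤ (∑ a, ∑ b, ∑ c, ‖S a b c‖ ^ 2) * ∑ s, ∑ a : Fin n × Fin n, ‖∑ m : Fin n, e s (a.1, m) (m, a.2)‖ ^ 2 := h1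
    _ ≤ (∑ a, ∑ b, ∑ c, ‖S a b c‖ ^ 2) * (C * (n : ℝ) ^ (3 - 2 * δ)) :=
        mul_le_mul_of_nonneg_left (hcap.trans htr) hnn
    _ = C * (n : ℝ) ^ (3 - 2 * δ) * ∑ a, ∑ b, ∑ c, ‖S a b c‖ ^ 2 := by ring

/-- **EQUIVALENCE.** The open stub of line `frame-negativity-singlet-fraction` is equivalent to the crux
`DiagonalPowerDecay`: the negativity relaxation of the capture loses nothing at the power scale. In particular the
stub is exactly as strong as the crux (hence implies `ω(ℂ) ≥ 6/(3−2δ) > 2`, `Cruxes/DiagonalPowerDecay/Disproof.lean`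
`omega_ge_of_body`), and it cannot be refuted by a product family that is "entangled in negativity but decorrelated
from the singlet" unless the crux itself falls. -/
theorem diagonalPowerDecay_iff_middlePairNegativityDecay : DiagonalPowerDecay ↔ MiddlePairNegativityDecay :=
  ⟨middlePairNegativityDecay_of_diagonalPowerDecay, diagonalPowerDecay_of_middlePairNegativityDecay⟩

end Equivalence

end Summit.MatrixMultiplication.MatrixMultiplication.Theorems.DiagonalPowerDecay

end
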